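import Literature.NumberTheory.LFunctions.MoebiusWalshGeomSums
import Literature.NumberTheory.LFunctions.MoebiusWalshLocalised
import Literature.NumberTheory.LFunctions.MoebiusWalshTypeIEstimate
import Mathlib.Analysis.SpecialFunctions.Pow.Real
import HarnessLib

/-!
# Type-II pair count for SHIFTED digit windows `K ≥ μ − ρ` (Bourgain 2013, §2 (2.11)–(2.12), (2.23)–(2.27)) — proved

Topic `Literature/NumberTheory/LFunctions`; a proofs companion of `MoebiusWalshCircuits.lean`
(named facts `bourgain_moebius_walsh_uniform`, `bourgain_liouville_walsh_uniform`, and the Sieve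
twin `Literature.NumberTheory.Sieve.bourgain_liouville_walsh`: J. Bourgain, *Möbius–Walsh
correlation bounds and an estimate of Mauduit and Rivat*, J. Anal. Math. **119** (2013) 147–163
= arXiv:1109.2784 [Bourgain2013MoebiusWalsh], Theorem 1). Everything here is PROVED (theorems, and
six elementary `def`s with bodies naming the quantities of the statement); no named fact.

It is the complement of `MoebiusWalshTypeIICore.lean` (`MoebiusWalshTypeII.typeII_core_zero`, the
unshifted window `K = 0`, (2.13)–(2.22)): the pair count for the SHIFTED windows
`[K, K + μ + ρ')`, `K ≥ μ − ρ` of §2 ((2.23)–(2.27)), where the Walsh factor is replaced by the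
localised substitute `W = W_{S'}` of Lemma 5 (tree: `MoebiusWalsh.localisedWalshRe`,
`MoebiusWalshLocalised.lean`). As there, the count is isolated as an ABSTRACT kernel-sum
inequality, so that it does not depend on how van der Corput (2.2), the carry truncation and the
`w ↦ W` substitution (2.3)–(2.4) are booked upstream, and logarithmic layers replace the paper's
smooth cutoff `M₁ = M^{1-ε₁}`.

## The quantity

After (2.2)–(2.8), for one lag `ℓ 2^K` (`ℓ ≠ 0`, `|ℓ| ≤ L`), with `P₀ = μ + ρ'` digits in the
window, `P = K + P₀`, Fourier data `a(k) = |Ŵ(k)| ≥ 0` on `|k| < R` (`R = 2^{P₀ + t + 1}`), the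
smooth variable `m` in a window of length `M` summed into the geometric-series majorant
`min(M, 1/(2‖θ‖))` (`Sieve.Vinogradov.geomBound`), and the long variable `N₀ ≤ n < N₀ + N`, one
faces (`sum_abs_sum_localisedWalshRe_mul_le_pairSum`, the expansion step (2.11) for `W`)

  `pairSum a R M K P₀ ℓ N₀ N = ∑_n ∑_{|k|,|k'|<R} a(k) a(k') min(M, 1/(2‖θ_{k,k'}(n)‖))`,
  `θ_{k,k'}(n) = (k − k')n/2^P + kℓ/2^{P₀}`                                   (`pairPhase`, (2.12)).

## What is proved (namespace `Literature.NumberTheory.LFunctions.MoebiusWalsh`)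

`pairSum ≤ diagonal + long arcs + ∑_{e<E} (short block e)` (`pairSum_le_parts`, `2R ≤ 2^E`), with

* `pairSum_diag_le` — **(2.13)–(2.14)**, `k = k'`: the phase `kℓ/2^{P₀}` does not depend on `n`;
  with the sup bound `a ≤ A`: `≤ N A² (2R/2^{P₀} + 2)(2^{v₂(ℓ)+1} M + 2^{P₀}(1 + log 2^{P₀}))`
  (tree: `sum_range_geomBound_mul_div_le`);
* `pairSum_long_le` — **(2.24)**, the pairs with `16(N₀+N)|k−k'| > 2^P` (the paper's
  `N ≳ ML2^K/Δk`: the phase makes `≳ 1` turn): every progression sum is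
  `≤ (log₂M+2)(2N + 64(N₀+N)) + 2M(2RN/2^P + 2)` (`sum_Ico_geomBound_pairPhase_le`, from the count
  `#{t < N : ‖x₀ + st‖ < δ} ≤ (sN+2)(2δ/s+1)`, `card_filter_distInt_arith_lt_le`, and the dyadic
  layer-cake `sum_geomBound_le_of_count`), whence `≤ A₁² (…)` with the `ℓ¹` bound `∑ a ≤ A₁`;
* `pairSum_block_le` — **(2.25)–(2.27)**, the short pairs with `2^e ≤ |k−k'| < 2^{e+1}`
  (`InShortBlock`): for ANY function `J` with `∑_{x ≤ k < x+Λ} a(k) ≤ J(Λ)` (`Λ ≥ 1`),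
  `≤ 2J(2^e)(2RL/2^{P₀} + 2)(Γ_e J(Λ(1/M + w_e)) + ∑_{i ≤ log₂M} min(Γ_e, NM/2^{i+1}) J(Λ(2^{i+1}/M + w_e)))`
  where `Γ_e = (log₂M+2)(2N + 4·2^P/2^e) + 33M/8` (`blockGamma`, the progression bound of a short
  pair), `w_e = 2^{e+1}(N₀+N)/2^P` (`blockW`, the excursion of the phase) and
  `Λ(η) = ⌊2η2^{P₀}⌋ + 1` (`confLen`). This is the paper's argument: "`‖k'ℓ/2^{μ+ρ'}‖ < 1/M₁ + Δk·N/(M2^{ρ'}2^K)`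
  … restricts `k'` to at most `L²` intervals of size `L^{1+2ε} + Δk·N/2^K`. Using Lemma 6 …"
  — the `k` with `‖kℓ/2^{P₀}‖ < 1/M + w_e` may resonate, those with
  `2^i/M + w_e ≤ ‖kℓ/2^{P₀}‖ < 2^{i+1}/M + w_e` keep all their phases at distance `≥ 2^i/M` from `ℤ`
  (`sum_Ico_geomBound_pairPhase_le_of_far`), each such set is confined to `2RL/2^{P₀} + 2` windows
  of length `Λ(·)` (`sum_filter_distInt_mul_div_lt_le`), and the partner `k'` of `k` lies in two
  windows of length `2^e`. The user takes `J(Λ) = 4Λ^κ` (Lemma 6) on the blocks with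
  `2^e(N₀+N)/2^K ≥ L^C` ((2.25)–(2.26)) and `J(Λ) = ‖a‖_∞ Λ` on the others ((2.27)).
* The Fourier data of `W` for these three inputs: `norm_localisedCoeff_le_sup` (sup, Lemma 2 via
  (1.13): `2·2^{-c₂|S'|}`), `sum_Ico_norm_localisedCoeff_le` (windows, Lemma 6: `4Λ^κ`,
  `1 ≤ Λ ≤ 2^P`), `sum_Ioo_norm_localisedCoeff_le` (`ℓ¹`, (1.11)/(2.10): `4(K+2)2^{κP₀}`).

Nothing here depends on the values of these constants; the numerical choice of the branches and of
`K`, `L`, `t` ((2.28)–(2.35)) belongs to the type-II estimate proper.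

## References

* J. Bourgain, J. Anal. Math. 119 (2013) 147–163; arXiv:1109.2784, §2 (2.11)–(2.14), (2.23)–(2.27);
  §1 Lemma 5 (1.11)–(1.13), Lemma 6 (1.24). [Bourgain2013MoebiusWalsh]
* C. Mauduit, J. Rivat, Ann. of Math. 171 (2010) 1591–1646, §5 (the type-II method being adapted).
* M. B. Nathanson, *Additive Number Theory: the Classical Bases*, GTM 164, §4.4 Lemma 4.7
  (geometric sums, through `VinogradovExpSumTools.lean`). [Nathanson1996]
-/

noncomputable section

open Finset Real

namespace Literature.NumberTheory.LFunctions.MoebiusWalsh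

open Literature.NumberTheory.Sieve.Vinogradov (distInt geomBound distInt_nonneg distInt_le_half
  distInt_add_int distInt_neg distInt_le_abs_sub_int distInt_add_le distInt_sub_le
  distInt_sub_distInt_le geomBound_le geomBound_le_inv geomBound_nonneg geomBound_neg geomBound_zero)

/-! ### Points of a real arithmetic progression close to the integers -/

/-- Naturals pairwise closer than `D ≥ 0` form a set of size `≤ D + 1`. [folklore] -/
theorem card_le_of_forall_dist_lt (s : Finset ℕ) {D : ℝ} (hD : 0 ≤ D)
    (h : ∀ t ∈ s, ∀ t' ∈ s, ((t : ℝ) - t' : ℝ) < D) : (s.card : ℝ) ≤ D + 1 := by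
  rcases s.eq_empty_or_nonempty with rfl | hne
  · simp only [Finset.card_empty, Nat.cast_zero]; linarith
  · have hsub : s ⊆ Icc (s.min' hne) (s.max' hne) := fun t ht =>
      Finset.mem_Icc.2 ⟨s.min'_le t ht, s.le_max' t ht⟩
    have hcard := Finset.card_le_card hsub
    rw [Nat.card_Icc] at hcard
    have hlt := h _ (s.max'_mem hne) _ (s.min'_mem hne)
    have hle : s.min' hne ≤ s.max' hne := s.min'_le _ (s.max'_mem hne)
    have h1 : (s.card : ℝ) ≤ ((s.max' hne + 1 - s.min' hne : ℕ) : ℝ) := by exact_mod_cast hcard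
    rw [Nat.cast_sub (by omega), Nat.cast_add, Nat.cast_one] at h1
    linarith

/-- **Points of an arithmetic progression near the integers.** For a real progression
`x₀ + s t` (`s > 0`), `δ ≥ 0` and `t < N`:
`#{t < N : ‖x₀ + st‖ < δ} ≤ (sN + 2)(2δ/s + 1)` — the progression passes at most `sN + 2`
integers, and stays within `δ` of each of them for at most `2δ/s + 1` steps.
[cite: Bourgain2013MoebiusWalsh, §2, after (2.23) ("letting n range over an interval of size
ML2^K/Δk, the number of possibilities for n in that interval is at most 1 + L^{1+2ε}2^K/Δk")] -/
theorem card_filter_distInt_arith_lt_le (x₀ : ℝ) {s : ℝ} (hs : 0 < s) {δ : ℝ} (hδ : 0 ≤ δ) (N : ℕ) :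
    ((((range N).filter fun t : ℕ => distInt (x₀ + s * t) < δ).card : ℕ) : ℝ) ≤
      (s * N + 2) * (2 * δ / s + 1) := by
  classical
  set F := (range N).filter fun t : ℕ => distInt (x₀ + s * t) < δ with hF
  let f : ℕ → ℤ := fun t => round (x₀ + s * t)
  have hf : ∀ t, f t = round (x₀ + s * t) := fun t => rfl
  -- fibres are short
  have hfib : ∀ j : ℤ, (((F.filter fun t => f t = j).card : ℕ) : ℝ) ≤ 2 * δ / s + 1 := by
    intro j
    refine card_le_of_forall_dist_lt _ (by positivity) fun t ht t' ht' => ?_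
    rw [Finset.mem_filter, hF, Finset.mem_filter, hf] at ht ht'
    have h1 : |x₀ + s * t - j| < δ := by
      have h := ht.1.2; unfold distInt at h; rw [ht.2] at h; exact h
    have h2 : |x₀ + s * t' - j| < δ := by
      have h := ht'.1.2; unfold distInt at h; rw [ht'.2] at h; exact h
    rw [abs_lt] at h1 h2
    rw [lt_div_iff₀ hs]
    nlinarith
  -- the image is small
  have himg : (((F.image f).card : ℕ) : ℝ) ≤ s * N + 2 := by
    rcases Nat.eq_zero_or_pos N with rfl | hN
    · have hF0 : F = ∅ := by rw [hF]; simp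
      rw [hF0, Finset.image_empty, Finset.card_empty, Nat.cast_zero]; positivity
    set z : ℤ := ⌊x₀ + s * ((N - 1 : ℕ) : ℝ) + 1 / 2⌋ + 1 - ⌈x₀ - 1 / 2⌉ with hz
    have hsub : F.image f ⊆ Finset.Icc ⌈x₀ - 1 / 2⌉ ⌊x₀ + s * ((N - 1 : ℕ) : ℝ) + 1 / 2⌋ := by
      intro j hj
      rw [Finset.mem_image] at hj
      obtain ⟨t, ht, rfl⟩ := hj
      rw [hF, Finset.mem_filter, Finset.mem_range] at ht
      have hr := abs_le.1 (abs_sub_round (x₀ + s * t))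
      have htN : (t : ℝ) ≤ ((N - 1 : ℕ) : ℝ) := by exact_mod_cast Nat.le_sub_one_of_lt ht.1
      have hst : s * t ≤ s * ((N - 1 : ℕ) : ℝ) := mul_le_mul_of_nonneg_left htN hs.le
      have hst0 : 0 ≤ s * t := by positivity
      rw [Finset.mem_Icc]
      refine ⟨Int.ceil_le.2 ?_, Int.le_floor.2 ?_⟩
      · rw [hf]; linarith [hr.2]
      · rw [hf]; linarith [hr.1]
    have hc := Finset.card_le_card hsub
    rw [Int.card_Icc, ← hz] at hc
    have h1 : (((F.image f).card : ℕ) : ℝ) ≤ ((z.toNat : ℕ) : ℝ) := by exact_mod_cast hc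
    refine h1.trans ?_
    have hN1 : (((N - 1 : ℕ) : ℝ)) = N - 1 := by rw [Nat.cast_sub hN]; simp
    rcases le_or_gt 0 z with h0 | h0
    · have hcast : ((z.toNat : ℕ) : ℝ) = (z : ℝ) := by
        rw [← Int.cast_natCast (R := ℝ), Int.toNat_of_nonneg h0]
      rw [hcast, hz]
      push_cast
      have hfl := Int.floor_le (x₀ + s * ((N - 1 : ℕ) : ℝ) + 1 / 2)
      have hce := Int.le_ceil (x₀ - 1 / 2)
      rw [hN1] at hfl ⊢
      nlinarith
    · rw [Int.toNat_of_nonpos h0.le, Nat.cast_zero]; positivity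
  -- assemble
  have hdecomp : ((F.card : ℕ) : ℝ) = ∑ j ∈ F.image f, (((F.filter fun t => f t = j).card : ℕ) : ℝ) := by
    rw [Finset.card_eq_sum_card_image f F]; push_cast; rfl
  rw [hdecomp]
  calc ∑ j ∈ F.image f, (((F.filter fun t => f t = j).card : ℕ) : ℝ)
      ≤ ∑ _j ∈ F.image f, (2 * δ / s + 1) := Finset.sum_le_sum fun j _ => hfib j
    _ = ((F.image f).card : ℝ) * (2 * δ / s + 1) := by rw [Finset.sum_const, nsmul_eq_mul]
    _ ≤ (s * N + 2) * (2 * δ / s + 1) := mul_le_mul_of_nonneg_right himg (by positivity)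


/-! ### From counts near the integers to sums of the kernel `min(M, 1/(2‖x‖))` -/

/-- **Dyadic layer-cake bound.** If, for every `η > 0`, at most `α η + β` of the points `x_t`
(`t ∈ T`) are within `η` of an integer, then
`∑_{t ∈ T} min(M, 1/(2‖x_t‖)) ≤ (log₂ M + 2) α + 2Mβ` (`M ≥ 1`): split the points according to
`‖x_t‖ < 1/M` (kernel `≤ M`) and `2^i/M ≤ ‖x_t‖ < 2^{i+1}/M`, `i ≤ log₂ M` (kernel `≤ M/2^{i+1}`).
[folklore] -/
theorem sum_geomBound_le_of_count {ι : Type*} (T : Finset ι) (x : ι → ℝ) {M : ℕ} (hM : 0 < M)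
    {α β : ℝ} (hβ : 0 ≤ β)
    (hcount : ∀ η : ℝ, 0 < η → ((T.filter fun t => distInt (x t) < η).card : ℝ) ≤ α * η + β) :
    ∑ t ∈ T, geomBound M (x t) ≤ ((Nat.log 2 M : ℝ) + 2) * α + 2 * M * β := by
  classical
  set I := Nat.log 2 M with hI
  have hM1 : (1 : ℝ) ≤ M := by exact_mod_cast hM
  have hMpos : (0 : ℝ) < M := by positivity
  have h2I : (M : ℝ) < 2 ^ (I + 1) := by exact_mod_cast Nat.lt_pow_succ_log_self one_lt_two M
  -- pointwise layer-cake majorant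
  have hpt : ∀ t ∈ T, geomBound M (x t) ≤
      M * (if distInt (x t) < 1 / M then 1 else 0) +
        ∑ i ∈ range (I + 1), (M : ℝ) / 2 ^ (i + 1) *
          (if distInt (x t) < 2 ^ (i + 1) / M then 1 else 0) := by
    intro t _
    have hnn : ∀ i ∈ range (I + 1), 0 ≤ (M : ℝ) / 2 ^ (i + 1) *
        (if distInt (x t) < 2 ^ (i + 1) / M then 1 else 0) := fun i _ => by
      split_ifs <;> positivity
    by_cases h0 : distInt (x t) < 1 / M
    · rw [if_pos h0, mul_one]
      exact le_add_of_le_of_nonneg (geomBound_le _ _) (Finset.sum_nonneg hnn)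
    · rw [if_neg h0, mul_zero, zero_add]
      have h0 := not_lt.mp h0
      -- the least `i` with `‖x_t‖ < 2^{i+1}/M`
      have hex : ∃ i, distInt (x t) < 2 ^ (i + 1) / M := ⟨I, by
        rw [lt_div_iff₀ hMpos]
        calc distInt (x t) * M ≤ 1 / 2 * M := mul_le_mul_of_nonneg_right (distInt_le_half _) hMpos.le
          _ < 2 ^ (I + 1) := by linarith⟩
      set i := Nat.find hex with hi
      have hi_spec : distInt (x t) < 2 ^ (i + 1) / M := Nat.find_spec hex
      have hi_le : i ≤ I := Nat.find_min' hex (by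
        rw [lt_div_iff₀ hMpos]
        calc distInt (x t) * M ≤ 1 / 2 * M := mul_le_mul_of_nonneg_right (distInt_le_half _) hMpos.le
          _ < 2 ^ (I + 1) := by linarith)
      have hlow : (2 : ℝ) ^ i / M ≤ distInt (x t) := by
        rcases Nat.eq_zero_or_pos i with h | h
        · rw [h, pow_zero]; exact h0
        · obtain ⟨j, hj⟩ : ∃ j, i = j + 1 := ⟨i - 1, by omega⟩
          have hmin := not_lt.mp (Nat.find_min hex (show j < Nat.find hex by rw [← hi]; omega))
          rw [hj]; exact hmin
      have hdpos : 0 < distInt (x t) := lt_of_lt_of_le (by positivity) hlow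
      calc geomBound M (x t) ≤ 1 / (2 * distInt (x t)) := geomBound_le_inv _ hdpos
        _ ≤ (M : ℝ) / 2 ^ (i + 1) := by
            rw [div_le_div_iff₀ (by positivity) (by positivity), pow_succ]
            rw [div_le_iff₀ hMpos] at hlow
            nlinarith
        _ = (M : ℝ) / 2 ^ (i + 1) * (if distInt (x t) < 2 ^ (i + 1) / M then 1 else 0) := by
            rw [if_pos hi_spec, mul_one]
        _ ≤ ∑ i ∈ range (I + 1), (M : ℝ) / 2 ^ (i + 1) *
              (if distInt (x t) < 2 ^ (i + 1) / M then 1 else 0) :=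
            Finset.single_le_sum hnn (Finset.mem_range.2 (by omega))
  -- sum the majorant
  have hcard : ∀ η : ℝ, ∑ t ∈ T, (if distInt (x t) < η then (1 : ℝ) else 0) =
      ((T.filter fun t => distInt (x t) < η).card : ℝ) := fun η => by
    rw [Finset.card_filter, Nat.cast_sum]
    refine Finset.sum_congr rfl fun t _ => ?_
    split_ifs <;> simp
  calc ∑ t ∈ T, geomBound M (x t)
      ≤ ∑ t ∈ T, (M * (if distInt (x t) < 1 / M then 1 else 0) +
          ∑ i ∈ range (I + 1), (M : ℝ) / 2 ^ (i + 1) *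
            (if distInt (x t) < 2 ^ (i + 1) / M then 1 else 0)) := Finset.sum_le_sum hpt
    _ = M * ((T.filter fun t => distInt (x t) < 1 / M).card : ℝ) +
          ∑ i ∈ range (I + 1), (M : ℝ) / 2 ^ (i + 1) *
            ((T.filter fun t => distInt (x t) < 2 ^ (i + 1) / M).card : ℝ) := by
        rw [Finset.sum_add_distrib, ← Finset.mul_sum, hcard, Finset.sum_comm]
        congr 1
        refine Finset.sum_congr rfl fun i _ => ?_
        rw [← Finset.mul_sum, hcard]
    _ ≤ M * (α * (1 / M) + β) +
          ∑ i ∈ range (I + 1), (M : ℝ) / 2 ^ (i + 1) * (α * (2 ^ (i + 1) / M) + β) := by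
        gcongr with i hi
        · exact hcount _ (by positivity)
        · exact hcount _ (by positivity)
    _ = (α + M * β) + ∑ i ∈ range (I + 1), (α + (M : ℝ) * β / 2 ^ (i + 1)) := by
        congr 1
        · field_simp
        · refine Finset.sum_congr rfl fun i _ => ?_
          field_simp
    _ ≤ (α + M * β) + ∑ i ∈ range (I + 1), (α + (M : ℝ) * β / 2 ^ (i + 1)) := le_rfl
    _ ≤ (α + M * β) + ((I + 1 : ℕ) * α + M * β) := by
        gcongr
        rw [Finset.sum_add_distrib, Finset.sum_const, Finset.card_range, nsmul_eq_mul]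
        gcongr
        -- `∑_{i ≤ I} Mβ/2^{i+1} ≤ Mβ`
        have hgeom : ∑ i ∈ range (I + 1), (1 : ℝ) / 2 ^ (i + 1) ≤ 1 := by
          have key : ∀ n : ℕ, ∑ i ∈ range n, (1 : ℝ) / 2 ^ (i + 1) = 1 - 1 / 2 ^ n := by
            intro n
            induction n with
            | zero => simp
            | succ n ih => rw [Finset.sum_range_succ, ih, pow_succ]; field_simp; ring
          rw [key]
          have : (0 : ℝ) < 1 / 2 ^ (I + 1) := by positivity
          linarith
        calc ∑ i ∈ range (I + 1), (M : ℝ) * β / 2 ^ (i + 1)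
            = (M * β) * ∑ i ∈ range (I + 1), (1 : ℝ) / 2 ^ (i + 1) := by
              rw [Finset.mul_sum]
              refine Finset.sum_congr rfl fun i _ => ?_
              field_simp
          _ ≤ (M * β) * 1 := mul_le_mul_of_nonneg_left hgeom (by positivity)
          _ = M * β := mul_one _
    _ = ((I : ℝ) + 2) * α + 2 * M * β := by push_cast; ring

/-- If all the points are at distance `≥ τ > 0` from the integers, the kernel sum is
`≤ |T|/(2τ)`. [folklore] -/
theorem sum_geomBound_le_card_div {ι : Type*} (T : Finset ι) (x : ι → ℝ) (M : ℝ) {τ : ℝ}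
    (hτ : 0 < τ) (hfar : ∀ t ∈ T, τ ≤ distInt (x t)) :
    ∑ t ∈ T, geomBound M (x t) ≤ (T.card : ℝ) / (2 * τ) := by
  calc ∑ t ∈ T, geomBound M (x t) ≤ ∑ _t ∈ T, 1 / (2 * τ) := by
        refine Finset.sum_le_sum fun t ht => ?_
        have hd : 0 < distInt (x t) := lt_of_lt_of_le hτ (hfar t ht)
        calc geomBound M (x t) ≤ 1 / (2 * distInt (x t)) := geomBound_le_inv _ hd
          _ ≤ 1 / (2 * τ) := by
              apply one_div_le_one_div_of_le (by positivity)
              linarith [hfar t ht]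
    _ = (T.card : ℝ) / (2 * τ) := by rw [Finset.sum_const, nsmul_eq_mul]; ring

/-- **Kernel sum along a progression.** For `s > 0`, `M ≥ 1` and `N` steps:
`∑_{t<N} min(M, 1/(2‖x₀+st‖)) ≤ (log₂ M + 2)(sN + 2)(2/s) + 2M(sN + 2)`. [folklore] -/
theorem sum_range_geomBound_arith_le (x₀ : ℝ) {s : ℝ} (hs : 0 < s) {M : ℕ} (hM : 0 < M) (N : ℕ) :
    ∑ t ∈ range N, geomBound M (x₀ + s * t) ≤
      ((Nat.log 2 M : ℝ) + 2) * ((s * N + 2) * (2 / s)) + 2 * M * (s * N + 2) := by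
  refine sum_geomBound_le_of_count (range N) (fun t : ℕ => x₀ + s * t) hM
    (by positivity) fun η hη => ?_
  calc (((range N).filter fun t : ℕ => distInt (x₀ + s * t) < η).card : ℝ)
      ≤ (s * N + 2) * (2 * η / s + 1) := card_filter_distInt_arith_lt_le x₀ hs hη.le N
    _ = (s * N + 2) * (2 / s) * η + (s * N + 2) := by field_simp



/-! ### Frequencies `k` with `kℓ/Q` close to an integer -/

/-- **Confinement of the resonant frequencies** (Bourgain 2013, §2, before (2.25): "this restricts
`k'` to at most `L²` intervals of size `L^{1+2ε} + ΔkN/2^K`"). For `f ≥ 0`, `ℓ ≠ 0` with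
`|ℓ| ≤ L`, `Q ≥ 1`, `η > 0`: the integers `|k| < R` with `‖kℓ/Q‖ < η` are covered by at most
`2RL/Q + 2` intervals of `⌊2ηQ⌋ + 1` consecutive integers (one for each integer `j` nearest to
`kℓ/Q`), so `∑_{|k|<R, ‖kℓ/Q‖<η} f(k) ≤ (2RL/Q + 2) B` whenever every such interval sum of `f` is
`≤ B`. [cite: Bourgain2013MoebiusWalsh, §2, between (2.24) and (2.25)] -/
theorem sum_filter_distInt_mul_div_lt_le {f : ℤ → ℝ} (hf : ∀ k, 0 ≤ f k) {Q : ℝ} (hQ : 1 ≤ Q)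
    {ℓ : ℤ} (hℓ : ℓ ≠ 0) {L : ℕ} (hℓL : ℓ.natAbs ≤ L) (R : ℕ) {η : ℝ} (hη : 0 < η) {B : ℝ}
    (hB : ∀ x : ℤ, ∑ k ∈ Ico x (x + ((⌊2 * η * Q⌋₊ + 1 : ℕ) : ℤ)), f k ≤ B) :
    ∑ k ∈ (Ioo (-(R : ℤ)) R).filter (fun k : ℤ => distInt (((k * ℓ : ℤ) : ℝ) / Q) < η), f k
      ≤ (2 * (R : ℝ) * L / Q + 2) * B := by
  classical
  set F := (Ioo (-(R : ℤ)) R).filter (fun k : ℤ => distInt (((k * ℓ : ℤ) : ℝ) / Q) < η) with hF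
  let g : ℤ → ℤ := fun k => round (((k * ℓ : ℤ) : ℝ) / Q)
  have hg : ∀ k, g k = round (((k * ℓ : ℤ) : ℝ) / Q) := fun k => rfl
  have hQ0 : (0 : ℝ) < Q := by linarith
  have hB0 : 0 ≤ B := le_trans (Finset.sum_nonneg fun k _ => hf k) (hB 0)
  have hℓ1 : (1 : ℝ) ≤ |(ℓ : ℝ)| := by
    rw [← Int.cast_abs]; exact_mod_cast Int.one_le_abs hℓ
  -- each fibre lies in a short interval
  have hfib : ∀ j : ℤ, ∑ k ∈ F.filter (fun k => g k = j), f k ≤ B := by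
    intro j
    set Fj := F.filter (fun k => g k = j) with hFj
    rcases Fj.eq_empty_or_nonempty with h0 | hne
    · rw [h0, Finset.sum_empty]; exact hB0
    · set x := Fj.min' hne with hx
      have hclose : ∀ k ∈ Fj, |((k * ℓ : ℤ) : ℝ) - j * Q| < η * Q := by
        intro k hk
        rw [hFj, Finset.mem_filter, hF, Finset.mem_filter, hg] at hk
        have h1 := hk.1.2
        unfold distInt at h1
        rw [hk.2] at h1
        have h2 : ((k * ℓ : ℤ) : ℝ) - j * Q = (((k * ℓ : ℤ) : ℝ) / Q - j) * Q := by field_simp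
        rw [h2, abs_mul, abs_of_pos hQ0]
        exact mul_lt_mul_of_pos_right h1 hQ0
      have hsub : Fj ⊆ Ico x (x + ((⌊2 * η * Q⌋₊ + 1 : ℕ) : ℤ)) := by
        intro k hk
        have hxk : x ≤ k := Fj.min'_le k hk
        have h1 := hclose k hk
        have h2 := hclose x (Fj.min'_mem hne)
        rw [abs_lt] at h1 h2
        -- `|k - x| |ℓ| < 2ηQ`
        have hdiff : ((k - x : ℤ) : ℝ) * |(ℓ : ℝ)| < 2 * η * Q := by
          have h3 : |(((k * ℓ : ℤ) : ℝ) - j * Q) - (((x * ℓ : ℤ) : ℝ) - j * Q)| < 2 * η * Q := by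
            rw [abs_lt]; constructor <;> linarith
          rw [show (((k * ℓ : ℤ) : ℝ) - j * Q) - (((x * ℓ : ℤ) : ℝ) - j * Q) = ((k - x : ℤ) : ℝ) * ℓ by
            push_cast; ring, abs_mul] at h3
          rwa [abs_of_nonneg (by exact_mod_cast sub_nonneg.2 hxk : (0 : ℝ) ≤ ((k - x : ℤ) : ℝ))] at h3
        have hdiff' : ((k - x : ℤ) : ℝ) < 2 * η * Q := by
          have h0 : (0 : ℝ) ≤ ((k - x : ℤ) : ℝ) := by exact_mod_cast sub_nonneg.2 hxk
          calc ((k - x : ℤ) : ℝ) = ((k - x : ℤ) : ℝ) * 1 := (mul_one _).symm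
            _ ≤ ((k - x : ℤ) : ℝ) * |(ℓ : ℝ)| := mul_le_mul_of_nonneg_left hℓ1 h0
            _ < 2 * η * Q := hdiff
        have hnat : ((k - x).toNat : ℝ) < 2 * η * Q := by
          rw [show ((k - x).toNat : ℝ) = (((k - x).toNat : ℤ) : ℝ) by norm_cast,
            Int.toNat_of_nonneg (sub_nonneg.2 hxk)]
          exact hdiff'
        have hfl : (k - x).toNat ≤ ⌊2 * η * Q⌋₊ := Nat.le_floor_iff (by positivity) |>.2 hnat.le
        rw [Finset.mem_Ico]
        constructor
        · exact hxk
        · have : k - x ≤ ((⌊2 * η * Q⌋₊ : ℕ) : ℤ) := by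
            have h5 : ((k - x).toNat : ℤ) = k - x := Int.toNat_of_nonneg (sub_nonneg.2 hxk)
            omega
          push_cast; omega
      calc ∑ k ∈ Fj, f k ≤ ∑ k ∈ Ico x (x + ((⌊2 * η * Q⌋₊ + 1 : ℕ) : ℤ)), f k :=
            Finset.sum_le_sum_of_subset_of_nonneg hsub fun k _ _ => hf k
        _ ≤ B := hB x
  -- the image of `g` is small
  have himg : (((F.image g).card : ℕ) : ℝ) ≤ 2 * (R : ℝ) * L / Q + 2 := by
    set Z : ℤ := ⌊(R : ℝ) * L / Q + 1 / 2⌋ with hZ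
    have hsub : F.image g ⊆ Finset.Icc (-Z) Z := by
      intro j hj
      rw [Finset.mem_image] at hj
      obtain ⟨k, hk, rfl⟩ := hj
      rw [hF, Finset.mem_filter, Finset.mem_Ioo] at hk
      have hr := abs_le.1 (abs_sub_round (((k * ℓ : ℤ) : ℝ) / Q))
      -- `|kℓ/Q| ≤ R L / Q`
      have hkl : |((k * ℓ : ℤ) : ℝ) / Q| ≤ (R : ℝ) * L / Q := by
        rw [abs_div, abs_of_pos hQ0, div_le_div_iff_of_pos_right hQ0]
        push_cast
        rw [abs_mul]
        have hk1 : |(k : ℝ)| ≤ R := by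
          rw [abs_le]; constructor <;> exact_mod_cast (by omega : _)
        have hl1 : |(ℓ : ℝ)| ≤ L := by
          rw [← Int.cast_abs]
          have : |ℓ| = (ℓ.natAbs : ℤ) := (Int.natCast_natAbs ℓ).symm
          rw [this]; exact_mod_cast hℓL
        exact mul_le_mul hk1 hl1 (abs_nonneg _) (Nat.cast_nonneg _)
      rw [abs_le] at hkl
      rw [Finset.mem_Icc, hg]
      constructor
      · rw [neg_le, hZ, Int.le_floor, Int.cast_neg]; linarith [hr.1, hr.2, hkl.1]
      · rw [hZ, Int.le_floor]; linarith [hr.1, hr.2, hkl.2]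
    have hc := Finset.card_le_card hsub
    rw [Int.card_Icc] at hc
    have hZ0 : 0 ≤ Z := by
      rw [hZ]; refine Int.floor_nonneg.2 ?_; positivity
    have h1 : (((F.image g).card : ℕ) : ℝ) ≤ (((Z + 1 - -Z).toNat : ℕ) : ℝ) := by exact_mod_cast hc
    refine h1.trans ?_
    rw [show (((Z + 1 - -Z).toNat : ℕ) : ℝ) = ((Z + 1 - -Z : ℤ) : ℝ) by
      rw [← Int.cast_natCast (R := ℝ), Int.toNat_of_nonneg (by omega)]]
    push_cast
    have hfl := Int.floor_le ((R : ℝ) * L / Q + 1 / 2)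
    rw [← hZ] at hfl
    have h2 : (2 * R * L / Q : ℝ) = 2 * ((R : ℝ) * L / Q) := by ring
    rw [h2]
    linarith
  -- assemble
  have hdecomp : ∑ k ∈ F, f k = ∑ j ∈ F.image g, ∑ k ∈ F.filter (fun k => g k = j), f k :=
    (Finset.sum_fiberwise_of_maps_to (fun k hk => Finset.mem_image_of_mem g hk) f).symm
  rw [hdecomp]
  calc ∑ j ∈ F.image g, ∑ k ∈ F.filter (fun k => g k = j), f k
      ≤ ∑ _j ∈ F.image g, B := Finset.sum_le_sum fun j _ => hfib j
    _ = ((F.image g).card : ℝ) * B := by rw [Finset.sum_const, nsmul_eq_mul]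
    _ ≤ (2 * (R : ℝ) * L / Q + 2) * B := mul_le_mul_of_nonneg_right himg hB0



/-! ### Windows of a periodic function on `ℤ` -/

/-- All windows of length `P` of a `P`-periodic function have the same sum. [folklore] -/
theorem sum_Ico_int_window_eq_of_periodic {M : Type*} [AddCommMonoid M] {f : ℤ → M} {P : ℕ}
    (hper : ∀ k, f (k + P) = f k) (c d : ℤ) :
    ∑ k ∈ Ico c (c + P), f k = ∑ k ∈ Ico d (d + P), f k := by
  rcases le_total c d with h | h
  · have := sum_Ico_int_eq_of_periodic hper d (d - c).toNat
    rwa [Int.toNat_of_nonneg (sub_nonneg.2 h), show d - (d - c) = c by ring] at this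
  · have := sum_Ico_int_eq_of_periodic hper c (c - d).toNat
    rw [Int.toNat_of_nonneg (sub_nonneg.2 h), show c - (c - d) = d by ring] at this
    exact this.symm

/-- A window of length `W` of a nonnegative `Q`-periodic function on `ℤ` has sum
`≤ (W/Q + 1) · (one period)`. [folklore] -/
theorem sum_Ico_int_le_of_periodic {g : ℤ → ℝ} (hg : ∀ k, 0 ≤ g k) {Q : ℕ} (hQ : 0 < Q)
    (hper : ∀ k, g (k + Q) = g k) (b : ℤ) (W : ℕ) :
    ∑ k ∈ Ico b (b + W), g k ≤ ((W : ℝ) / Q + 1) * ∑ k ∈ Ico (0 : ℤ) Q, g k := by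
  set n := W / Q + 1 with hn
  have hWn : W ≤ n * Q := by
    rw [hn]; have := Nat.lt_mul_div_succ W hQ; rw [mul_comm] at this
    have h2 : Q * (W / Q + 1) = (W / Q + 1) * Q := mul_comm _ _
    omega
  have hB0 : 0 ≤ ∑ k ∈ Ico (0 : ℤ) Q, g k := Finset.sum_nonneg fun k _ => hg k
  calc ∑ k ∈ Ico b (b + W), g k ≤ ∑ k ∈ Ico b (b + (n * Q : ℕ)), g k := by
        refine Finset.sum_le_sum_of_subset_of_nonneg (Finset.Ico_subset_Ico le_rfl ?_) fun k _ _ => hg k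
        have : (W : ℤ) ≤ ((n * Q : ℕ) : ℤ) := by exact_mod_cast hWn
        omega
    _ = ∑ i ∈ range n, ∑ k ∈ Ico (b + i * Q) (b + (i + 1) * Q), g k := by
        rw [show ((n * Q : ℕ) : ℤ) = (n : ℤ) * Q by push_cast; ring]; exact sum_Ico_int_blocks g b Q n
    _ = ∑ _i ∈ range n, ∑ k ∈ Ico (0 : ℤ) Q, g k := by
        refine Finset.sum_congr rfl fun i _ => ?_
        rw [show b + ((i : ℕ) + 1 : ℤ) * Q = (b + i * Q) + Q by ring]
        have := sum_Ico_int_window_eq_of_periodic hper (b + i * Q) 0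
        rwa [zero_add] at this
    _ = (n : ℝ) * ∑ k ∈ Ico (0 : ℤ) Q, g k := by rw [Finset.sum_const, Finset.card_range, nsmul_eq_mul]
    _ ≤ ((W : ℝ) / Q + 1) * ∑ k ∈ Ico (0 : ℤ) Q, g k := by
        refine mul_le_mul_of_nonneg_right ?_ hB0
        rw [hn]; push_cast
        have : ((W / Q : ℕ) : ℝ) ≤ (W : ℝ) / Q := Nat.cast_div_le
        linarith

/-! ### The pair sum (2.11) and the phase (2.12) -/

/-- The phase of (2.12): `θ_{k,k'}(n) = (k-k')n/2^{K+P₀} + kℓ/2^{P₀}` (the paper's `μ + ρ' = P₀`,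
shift `ℓ 2^K`). [cite: Bourgain2013MoebiusWalsh, (2.12)] -/
def pairPhase (K P₀ : ℕ) (ℓ k k' : ℤ) (n : ℕ) : ℝ :=
  ((k - k' : ℤ) : ℝ) * n / 2 ^ (K + P₀) + ((k * ℓ : ℤ) : ℝ) / 2 ^ P₀

/-- **The pair sum** majorising (2.11) for one lag `ℓ 2^K`: with nonnegative weights `a(k)`
(the absolute Fourier coefficients of the localised Walsh factor, `|k| < R`) and the geometric-sum
kernel of the `m`-summation of length `M`,
`∑_{N₀ ≤ n < N₀+N} ∑_{|k|,|k'|<R} a(k) a(k') min(M, 1/(2‖θ_{k,k'}(n)‖))`.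
[cite: Bourgain2013MoebiusWalsh, (2.11)] -/
def pairSum (a : ℤ → ℝ) (R M K P₀ : ℕ) (ℓ : ℤ) (N₀ N : ℕ) : ℝ :=
  ∑ n ∈ Ico N₀ (N₀ + N), ∑ k ∈ Ioo (-(R : ℤ)) R, ∑ k' ∈ Ioo (-(R : ℤ)) R,
    a k * a k' * geomBound M (pairPhase K P₀ ℓ k k' n)

/-- On the diagonal `k = k'` the phase is `kℓ/2^{P₀}`, independent of `n`.
[cite: Bourgain2013MoebiusWalsh, (2.13)] -/
theorem pairPhase_self (K P₀ : ℕ) (ℓ k : ℤ) (n : ℕ) :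
    pairPhase K P₀ ℓ k k n = ((k * ℓ : ℤ) : ℝ) / 2 ^ P₀ := by
  simp [pairPhase]

/-- **The diagonal `k = k'` (Bourgain 2013, (2.13)–(2.14))**: for `0 ≤ a ≤ A` and `ℓ ≠ 0`,
`∑_n ∑_{|k|<R} a(k)² min(M, 1/(2‖kℓ/2^{P₀}‖)) ≤ N A² (2R/2^{P₀} + 2)(2^{v₂(ℓ)+1} M + 2^{P₀}(1 + log 2^{P₀}))`
(the multiples `kℓ/2^{P₀}` run `2^{v₂(ℓ)}`-to-one over a grid of mesh `2^{v₂(ℓ)-P₀}`; tree: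
`sum_range_geomBound_mul_div_le`). [cite: Bourgain2013MoebiusWalsh, (2.13)–(2.14)] -/
theorem pairSum_diag_le {a : ℤ → ℝ} {A : ℝ} (ha0 : ∀ k, 0 ≤ a k) (haA : ∀ k, a k ≤ A)
    (R M K P₀ : ℕ) {ℓ : ℤ} (hℓ : ℓ ≠ 0) (N₀ N : ℕ) :
    ∑ n ∈ Ico N₀ (N₀ + N), ∑ k ∈ Ioo (-(R : ℤ)) R, a k * a k * geomBound M (pairPhase K P₀ ℓ k k n) ≤
      N * A ^ 2 * ((2 * (R : ℝ) / 2 ^ P₀ + 2) *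
        (2 ^ (ℓ.natAbs.factorization 2 + 1) * M + 2 ^ P₀ * (1 + Real.log (2 ^ P₀)))) := by
  set Q : ℕ := 2 ^ P₀ with hQ
  have hQpos : 0 < Q := Nat.two_pow_pos P₀
  have hQr : ((Q : ℕ) : ℝ) = (2 : ℝ) ^ P₀ := by rw [hQ]; push_cast; ring
  set g : ℤ → ℝ := fun k => geomBound M (((k * ℓ : ℤ) : ℝ) / 2 ^ P₀) with hg
  have hg0 : ∀ k, 0 ≤ g k := fun k => geomBound_nonneg (Nat.cast_nonneg M) _
  have hgper : ∀ k, g (k + Q) = g k := by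
    intro k
    simp only [hg]
    rw [show ((((k + Q) * ℓ : ℤ)) : ℝ) / 2 ^ P₀ = ((k * ℓ : ℤ) : ℝ) / 2 ^ P₀ + ((ℓ : ℤ) : ℝ) by
      rw [← hQr]; push_cast; field_simp]
    unfold geomBound; rw [distInt_add_int]
  -- one period of `g`
  have hperiod : ∑ k ∈ Ico (0 : ℤ) Q, g k ≤
      2 ^ (ℓ.natAbs.factorization 2 + 1) * M + 2 ^ P₀ * (1 + Real.log (2 ^ P₀)) := by
    have hℓ' : ℓ.natAbs ≠ 0 := Int.natAbs_ne_zero.2 hℓ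
    have h := sum_range_geomBound_mul_div_le hℓ' P₀ (Nat.cast_nonneg M) 0
    have hIco : ∑ k ∈ Ico (0 : ℤ) Q, g k = ∑ j ∈ range Q, g ((0 : ℤ) + j) := by
      have := sum_Ico_int_eq_sum_range g 0 Q; rwa [zero_add] at this
    rw [hIco]
    refine le_trans (le_of_eq (Finset.sum_congr rfl fun j _ => ?_)) h
    simp only [hg, zero_add, add_zero]
    -- `ℓ = ± |ℓ|`
    rcases Int.natAbs_eq ℓ with hpos | hneg
    · congr 1; rw [hpos]; push_cast; simp; ring
    · rw [← geomBound_neg]; congr 1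
      conv_lhs => rw [hneg]
      push_cast; simp; ring
  have hperiod0 : 0 ≤ ∑ k ∈ Ico (0 : ℤ) Q, g k := Finset.sum_nonneg fun k _ => hg0 k
  -- the full frequency range
  have hfreq : ∑ k ∈ Ioo (-(R : ℤ)) R, g k ≤ (2 * (R : ℝ) / 2 ^ P₀ + 2) *
      (2 ^ (ℓ.natAbs.factorization 2 + 1) * M + 2 ^ P₀ * (1 + Real.log (2 ^ P₀))) := by
    have hsub : Ioo (-(R : ℤ)) R ⊆ Ico (-(R : ℤ)) (-(R : ℤ) + (2 * R : ℕ)) := by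
      intro k hk; rw [Finset.mem_Ioo] at hk; rw [Finset.mem_Ico]; push_cast; omega
    calc ∑ k ∈ Ioo (-(R : ℤ)) R, g k ≤ ∑ k ∈ Ico (-(R : ℤ)) (-(R : ℤ) + (2 * R : ℕ)), g k :=
          Finset.sum_le_sum_of_subset_of_nonneg hsub fun k _ _ => hg0 k
      _ ≤ (((2 * R : ℕ) : ℝ) / Q + 1) * ∑ k ∈ Ico (0 : ℤ) Q, g k :=
          sum_Ico_int_le_of_periodic hg0 hQpos hgper _ _
      _ ≤ (2 * (R : ℝ) / 2 ^ P₀ + 2) *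
          (2 ^ (ℓ.natAbs.factorization 2 + 1) * M + 2 ^ P₀ * (1 + Real.log (2 ^ P₀))) := by
          refine mul_le_mul ?_ hperiod hperiod0 (by positivity)
          rw [hQr]; push_cast; linarith
  have hfreq0 : 0 ≤ ∑ k ∈ Ioo (-(R : ℤ)) R, g k := Finset.sum_nonneg fun k _ => hg0 k
  have hA0 : 0 ≤ A := le_trans (ha0 0) (haA 0)
  -- assemble
  calc ∑ n ∈ Ico N₀ (N₀ + N), ∑ k ∈ Ioo (-(R : ℤ)) R, a k * a k * geomBound M (pairPhase K P₀ ℓ k k n)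
      = ∑ _n ∈ Ico N₀ (N₀ + N), ∑ k ∈ Ioo (-(R : ℤ)) R, a k * a k * g k := by
        refine Finset.sum_congr rfl fun n _ => Finset.sum_congr rfl fun k _ => ?_
        rw [pairPhase_self]
    _ ≤ ∑ _n ∈ Ico N₀ (N₀ + N), ∑ k ∈ Ioo (-(R : ℤ)) R, A ^ 2 * g k := by
        refine Finset.sum_le_sum fun n _ => Finset.sum_le_sum fun k _ => ?_
        refine mul_le_mul_of_nonneg_right ?_ (hg0 k)
        rw [sq]; exact mul_le_mul (haA k) (haA k) (ha0 k) hA0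
    _ = N * (A ^ 2 * ∑ k ∈ Ioo (-(R : ℤ)) R, g k) := by
        rw [Finset.sum_const, Nat.card_Ico, show N₀ + N - N₀ = N by omega, nsmul_eq_mul, Finset.mul_sum]
        rw [Finset.mul_sum, Finset.mul_sum]
    _ ≤ N * (A ^ 2 * ((2 * (R : ℝ) / 2 ^ P₀ + 2) *
        (2 ^ (ℓ.natAbs.factorization 2 + 1) * M + 2 ^ P₀ * (1 + Real.log (2 ^ P₀))))) := by
        gcongr
    _ = _ := by ring



/-! ### One pair `(k, k')`: the `n`-sum is a progression sum -/

/-- For `k ≠ k'` the phases `θ_{k,k'}(N₀ + t)`, `t < N`, form (up to sign) a real progression of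
step `s = |k-k'|/2^{K+P₀}`, so `∑_{N₀ ≤ n < N₀+N} min(M, 1/(2‖θ_{k,k'}(n)‖)) ≤ (log₂M + 2)(sN+2)(2/s) + 2M(sN+2)`.
[cite: Bourgain2013MoebiusWalsh, (2.12), (2.24)–(2.25)] -/
theorem sum_Ico_geomBound_pairPhase_le {M : ℕ} (hM : 0 < M) (K P₀ : ℕ) (ℓ : ℤ) {k k' : ℤ}
    (hkk : k ≠ k') (N₀ N : ℕ) :
    ∑ n ∈ Ico N₀ (N₀ + N), geomBound M (pairPhase K P₀ ℓ k k' n) ≤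
      ((Nat.log 2 M : ℝ) + 2) * ((|((k - k' : ℤ) : ℝ)| / 2 ^ (K + P₀) * N + 2) *
        (2 / (|((k - k' : ℤ) : ℝ)| / 2 ^ (K + P₀)))) +
      2 * M * (|((k - k' : ℤ) : ℝ)| / 2 ^ (K + P₀) * N + 2) := by
  set s : ℝ := |((k - k' : ℤ) : ℝ)| / 2 ^ (K + P₀) with hs
  have hd0 : ((k - k' : ℤ) : ℝ) ≠ 0 := by exact_mod_cast sub_ne_zero.2 hkk
  have hs0 : 0 < s := by rw [hs]; positivity
  rw [Finset.sum_Ico_eq_sum_range, show N₀ + N - N₀ = N by omega]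
  rcases lt_or_gt_of_ne hd0 with hneg | hpos
  · -- negative step: use evenness of the kernel
    set x₀ : ℝ := -(((k - k' : ℤ) : ℝ) * N₀ / 2 ^ (K + P₀) + ((k * ℓ : ℤ) : ℝ) / 2 ^ P₀) with hx₀
    have habs : |((k - k' : ℤ) : ℝ)| = -((k - k' : ℤ) : ℝ) := abs_of_neg hneg
    have hterm : ∀ t : ℕ, geomBound M (pairPhase K P₀ ℓ k k' (N₀ + t)) = geomBound M (x₀ + s * t) := by
      intro t
      rw [← geomBound_neg]
      congr 1
      rw [pairPhase, hx₀, hs, habs]; push_cast; ring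
    rw [Finset.sum_congr rfl fun t _ => hterm t]
    exact sum_range_geomBound_arith_le x₀ hs0 hM N
  · set x₀ : ℝ := ((k - k' : ℤ) : ℝ) * N₀ / 2 ^ (K + P₀) + ((k * ℓ : ℤ) : ℝ) / 2 ^ P₀ with hx₀
    have habs : |((k - k' : ℤ) : ℝ)| = ((k - k' : ℤ) : ℝ) := abs_of_pos hpos
    have hterm : ∀ t : ℕ, geomBound M (pairPhase K P₀ ℓ k k' (N₀ + t)) = geomBound M (x₀ + s * t) := by
      intro t
      congr 1
      rw [pairPhase, hx₀, hs, habs]; push_cast; ring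
    rw [Finset.sum_congr rfl fun t _ => hterm t]
    exact sum_range_geomBound_arith_le x₀ hs0 hM N

/-- If moreover `‖kℓ/2^{P₀}‖ ≥ τ + w` where `w ≥ |k-k'|(N₀+N)/2^{K+P₀}` bounds the total
excursion of the progression, every phase is at distance `≥ τ` from `ℤ` and the `n`-sum is
`≤ N/(2τ)`. [cite: Bourgain2013MoebiusWalsh, §2, before (2.25)] -/
theorem sum_Ico_geomBound_pairPhase_le_of_far (M : ℝ) (K P₀ : ℕ) (ℓ k k' : ℤ) (N₀ N : ℕ)
    {τ w : ℝ} (hτ : 0 < τ) (hw : |((k - k' : ℤ) : ℝ)| * (N₀ + N : ℕ) / 2 ^ (K + P₀) ≤ w)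
    (hfar : τ + w ≤ distInt (((k * ℓ : ℤ) : ℝ) / 2 ^ P₀)) :
    ∑ n ∈ Ico N₀ (N₀ + N), geomBound M (pairPhase K P₀ ℓ k k' n) ≤ (N : ℝ) / (2 * τ) := by
  have h := sum_geomBound_le_card_div (Ico N₀ (N₀ + N)) (fun n => pairPhase K P₀ ℓ k k' n) M hτ ?_
  · rwa [Nat.card_Ico, show N₀ + N - N₀ = N by omega] at h
  intro n hn
  rw [Finset.mem_Ico] at hn
  -- `‖θ(n)‖ ≥ ‖kℓ/2^{P₀}‖ - |(k-k')n/2^{K+P₀}|`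
  have h1 := distInt_sub_distInt_le (pairPhase K P₀ ℓ k k' n) (((k * ℓ : ℤ) : ℝ) / 2 ^ P₀)
  have h2 : distInt (pairPhase K P₀ ℓ k k' n - ((k * ℓ : ℤ) : ℝ) / 2 ^ P₀) ≤ w := by
    have h3 : pairPhase K P₀ ℓ k k' n - ((k * ℓ : ℤ) : ℝ) / 2 ^ P₀ =
        ((k - k' : ℤ) : ℝ) * n / 2 ^ (K + P₀) := by rw [pairPhase]; ring
    rw [h3]
    have h4 : distInt (((k - k' : ℤ) : ℝ) * n / 2 ^ (K + P₀)) ≤ |((k - k' : ℤ) : ℝ) * n / 2 ^ (K + P₀)| := by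
      have h5 := distInt_le_abs_sub_int (((k - k' : ℤ) : ℝ) * n / 2 ^ (K + P₀)) 0
      rwa [Int.cast_zero, sub_zero] at h5
    refine le_trans h4 (le_trans ?_ hw)
    rw [abs_div, abs_of_pos (by positivity : (0 : ℝ) < 2 ^ (K + P₀)), abs_mul, Nat.abs_cast]
    refine div_le_div_of_nonneg_right (mul_le_mul_of_nonneg_left ?_ (abs_nonneg _)) (by positivity)
    exact_mod_cast hn.2.le
  linarith

/-! ### The long arcs `|k - k'|(N₀+N) > 2^{K+P₀}/16` (Bourgain 2013, (2.24)) -/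

/-- **Long arcs.** Over the pairs with `16 (N₀+N)|k-k'| > 2^{K+P₀}` (the phase runs through
`≳ 1` full turns as `n` varies — the paper's case `N ≳ ML2^K/Δk`), the pair sum is at most
`A₁² ((log₂M + 2)(2N + 64(N₀+N)) + 2M(2RN/2^{K+P₀} + 2))`, `A₁ = ∑_k a(k)`: each progression sum
is bounded by `sum_Ico_geomBound_pairPhase_le` with `2^{K+P₀}/|k-k'| < 16(N₀+N)` and
`|k-k'| < 2R`. [cite: Bourgain2013MoebiusWalsh, (2.24)] -/
theorem pairSum_long_le {a : ℤ → ℝ} (ha0 : ∀ k, 0 ≤ a k) {A₁ : ℝ} {R : ℕ}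
    (hA₁ : ∑ k ∈ Ioo (-(R : ℤ)) R, a k ≤ A₁) {M : ℕ} (hM : 0 < M) (K P₀ : ℕ) (ℓ : ℤ) (N₀ N : ℕ) :
    ∑ n ∈ Ico N₀ (N₀ + N), ∑ k ∈ Ioo (-(R : ℤ)) R, ∑ k' ∈ Ioo (-(R : ℤ)) R,
      (if (2 : ℤ) ^ (K + P₀) < 16 * ((N₀ + N : ℕ) : ℤ) * |k - k'| then
        a k * a k' * geomBound M (pairPhase K P₀ ℓ k k' n) else 0) ≤
      A₁ ^ 2 * (((Nat.log 2 M : ℝ) + 2) * (2 * N + 64 * (N₀ + N : ℕ)) +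
        2 * M * (2 * R * N / 2 ^ (K + P₀) + 2)) := by
  set P := K + P₀ with hP
  set Λ : ℝ := ((Nat.log 2 M : ℝ) + 2) * (2 * N + 64 * (N₀ + N : ℕ)) +
    2 * M * (2 * R * N / 2 ^ P + 2) with hΛ
  have hΛ0 : 0 ≤ Λ := by rw [hΛ]; positivity
  have hA0 : 0 ≤ ∑ k ∈ Ioo (-(R : ℤ)) R, a k := Finset.sum_nonneg fun k _ => ha0 k
  -- per pair
  have hpair : ∀ k ∈ Ioo (-(R : ℤ)) R, ∀ k' ∈ Ioo (-(R : ℤ)) R,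
      (2 : ℤ) ^ P < 16 * ((N₀ + N : ℕ) : ℤ) * |k - k'| →
      ∑ n ∈ Ico N₀ (N₀ + N), geomBound M (pairPhase K P₀ ℓ k k' n) ≤ Λ := by
    intro k hk k' hk' hlong
    rw [Finset.mem_Ioo] at hk hk'
    have hkk : k ≠ k' := by
      rintro rfl
      rw [sub_self, abs_zero, mul_zero] at hlong
      exact absurd hlong (not_lt.2 (by positivity))
    refine (sum_Ico_geomBound_pairPhase_le hM K P₀ ℓ hkk N₀ N).trans ?_
    set d : ℝ := |((k - k' : ℤ) : ℝ)| with hd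
    have hd0 : 0 < d := by rw [hd]; exact abs_pos.2 (by exact_mod_cast sub_ne_zero.2 hkk)
    have hdR : d ≤ 2 * R := by
      rw [hd, abs_le]; constructor <;> push_cast <;>
        [exact_mod_cast (by omega : -(2 * (R : ℤ)) ≤ k - k'); exact_mod_cast (by omega : k - k' ≤ 2 * (R : ℤ))]
    have h2P : (0 : ℝ) < 2 ^ P := by positivity
    -- `2^P / d < 16 (N₀ + N)`
    have hinv : 2 / (d / 2 ^ P) ≤ 32 * (N₀ + N : ℕ) := by
      have hlong' : (2 : ℝ) ^ P < 16 * (N₀ + N : ℕ) * d := by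
        rw [hd, ← Int.cast_abs]; exact_mod_cast hlong
      rw [div_div_eq_mul_div, div_le_iff₀ hd0]
      linarith
    have hsN : d / 2 ^ P * N ≤ 2 * R * N / 2 ^ P := by
      rw [div_mul_eq_mul_div]
      exact div_le_div_of_nonneg_right (mul_le_mul_of_nonneg_right hdR (Nat.cast_nonneg N)) h2P.le
    rw [hΛ]
    have hI : (0 : ℝ) ≤ (Nat.log 2 M : ℝ) + 2 := by positivity
    have hM0 : (0 : ℝ) ≤ 2 * M := by positivity
    have e1 : (d / 2 ^ P * N + 2) * (2 / (d / 2 ^ P)) = 2 * N + 2 * (2 / (d / 2 ^ P)) := by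
      field_simp
    rw [e1]
    gcongr ?_ * ?_ + ?_ * (?_ + 2)
    · linarith
  -- sum over the pairs
  calc ∑ n ∈ Ico N₀ (N₀ + N), ∑ k ∈ Ioo (-(R : ℤ)) R, ∑ k' ∈ Ioo (-(R : ℤ)) R,
        (if (2 : ℤ) ^ P < 16 * ((N₀ + N : ℕ) : ℤ) * |k - k'| then
          a k * a k' * geomBound M (pairPhase K P₀ ℓ k k' n) else 0)
      = ∑ k ∈ Ioo (-(R : ℤ)) R, ∑ k' ∈ Ioo (-(R : ℤ)) R,
          (if (2 : ℤ) ^ P < 16 * ((N₀ + N : ℕ) : ℤ) * |k - k'| then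
            a k * a k' * ∑ n ∈ Ico N₀ (N₀ + N), geomBound M (pairPhase K P₀ ℓ k k' n) else 0) := by
        rw [Finset.sum_comm]
        refine Finset.sum_congr rfl fun k _ => ?_
        rw [Finset.sum_comm]
        refine Finset.sum_congr rfl fun k' _ => ?_
        split_ifs
        · rw [Finset.mul_sum]
        · simp
    _ ≤ ∑ k ∈ Ioo (-(R : ℤ)) R, ∑ k' ∈ Ioo (-(R : ℤ)) R, a k * a k' * Λ := by
        refine Finset.sum_le_sum fun k hk => Finset.sum_le_sum fun k' hk' => ?_
        split_ifs with h
        · exact mul_le_mul_of_nonneg_left (hpair k hk k' hk' h) (mul_nonneg (ha0 k) (ha0 k'))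
        · exact mul_nonneg (mul_nonneg (ha0 k) (ha0 k')) hΛ0
    _ = (∑ k ∈ Ioo (-(R : ℤ)) R, a k) ^ 2 * Λ := by
        rw [sq, Finset.sum_mul_sum, Finset.sum_mul]
        refine Finset.sum_congr rfl fun k _ => ?_
        rw [Finset.sum_mul]
    _ ≤ A₁ ^ 2 * Λ := by
        refine mul_le_mul_of_nonneg_right ?_ hΛ0
        exact pow_le_pow_left₀ hA0 hA₁ 2



/-! ### The short arcs, by dyadic size `2^e ≤ |k - k'| < 2^{e+1}` (Bourgain 2013, (2.25)–(2.27)) -/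

/-- Membership in the `e`-th short block: `k ≠ k'`, `16(N₀+N)|k-k'| ≤ 2^{K+P₀}` (the phase moves by
at most `1/16` as `n` runs — the paper's case `N ≪ ML2^K/Δk`) and `2^e ≤ |k-k'| < 2^{e+1}`.
[cite: Bourgain2013MoebiusWalsh, §2, "Fix ℓ, k, k' with |k-k'| ∼ Δk"] -/
def InShortBlock (K P₀ Ntop e : ℕ) (k k' : ℤ) : Prop :=
  k ≠ k' ∧ 16 * (Ntop : ℤ) * |k - k'| ≤ (2 : ℤ) ^ (K + P₀) ∧ (2 : ℤ) ^ e ≤ |k - k'| ∧ |k - k'| < (2 : ℤ) ^ (e + 1)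

/-- Membership in a short block is decidable. [folklore] -/
instance (K P₀ Ntop e : ℕ) (k k' : ℤ) : Decidable (InShortBlock K P₀ Ntop e k k') := by
  unfold InShortBlock; infer_instance

/-- The length of the confinement intervals for `‖kℓ/2^{P₀}‖ < η`: `⌊2η2^{P₀}⌋ + 1`.
[cite: Bourgain2013MoebiusWalsh, §2, before (2.25)] -/
def confLen (P₀ : ℕ) (η : ℝ) : ℕ := ⌊2 * η * (2 : ℝ) ^ P₀⌋₊ + 1

/-- `confLen` is monotone in `η`. [folklore] -/
theorem confLen_mono (P₀ : ℕ) {η η' : ℝ} (h : η ≤ η') : confLen P₀ η ≤ confLen P₀ η' := by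
  unfold confLen
  exact Nat.succ_le_succ (Nat.floor_le_floor (by gcongr))

/-- `1 ≤ confLen`. [folklore] -/
theorem one_le_confLen (P₀ : ℕ) (η : ℝ) : 1 ≤ confLen P₀ η := Nat.succ_le_succ (Nat.zero_le _)

/-- The progression bound of a short pair: with `s = |k-k'|/2^{K+P₀} ∈ [2^e, 2^{e+1})/2^{K+P₀}` and
`sN ≤ 1/16`, `(log₂M + 2)(sN+2)(2/s) + 2M(sN+2) ≤ Γ_e := (log₂M + 2)(2N + 4·2^{K+P₀}/2^e) + 33M/8`.
[cite: Bourgain2013MoebiusWalsh, (2.25)] -/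
def blockGamma (M K P₀ N e : ℕ) : ℝ :=
  ((Nat.log 2 M : ℝ) + 2) * (2 * N + 4 * (2 : ℝ) ^ (K + P₀) / 2 ^ e) + 33 * M / 8

/-- `Γ_e ≥ 0`. [folklore] -/
theorem blockGamma_nonneg (M K P₀ N e : ℕ) : 0 ≤ blockGamma M K P₀ N e := by
  unfold blockGamma; positivity

/-- The excursion bound of block `e`: `w_e = 2^{e+1}(N₀+N)/2^{K+P₀}` (`≤ 1/8`).
[cite: Bourgain2013MoebiusWalsh, §2, "‖k'ℓ/2^{μ+ρ'}‖ < 1/M₁ + Δk·N/(M2^{ρ'}2^K)"] -/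
def blockW (K P₀ Ntop e : ℕ) : ℝ := (2 : ℝ) ^ (e + 1) * Ntop / 2 ^ (K + P₀)

/-- `w_e ≥ 0`. [folklore] -/
theorem blockW_nonneg (K P₀ Ntop e : ℕ) : 0 ≤ blockW K P₀ Ntop e := by unfold blockW; positivity

/-- A short pair has its `n`-sum bounded by `Γ_e`. [cite: Bourgain2013MoebiusWalsh, (2.25)] -/
theorem sum_Ico_geomBound_pairPhase_le_blockGamma {M : ℕ} (hM : 0 < M) (K P₀ : ℕ) (ℓ : ℤ)
    {N₀ N e : ℕ} {k k' : ℤ} (hb : InShortBlock K P₀ (N₀ + N) e k k') :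
    ∑ n ∈ Ico N₀ (N₀ + N), geomBound M (pairPhase K P₀ ℓ k k' n) ≤ blockGamma M K P₀ N e := by
  obtain ⟨hkk, h16, hlo, hhi⟩ := hb
  refine (sum_Ico_geomBound_pairPhase_le hM K P₀ ℓ hkk N₀ N).trans ?_
  set d : ℝ := |((k - k' : ℤ) : ℝ)| with hd
  set P := K + P₀ with hP
  have h2P : (0 : ℝ) < 2 ^ P := by positivity
  have hdlo : (2 : ℝ) ^ e ≤ d := by rw [hd, ← Int.cast_abs]; exact_mod_cast hlo
  have hd0 : 0 < d := lt_of_lt_of_le (by positivity) hdlo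
  have h16' : 16 * ((N₀ + N : ℕ) : ℝ) * d ≤ 2 ^ P := by rw [hd, ← Int.cast_abs]; exact_mod_cast h16
  -- `sN ≤ 1/16`
  have hsN : d / 2 ^ P * N ≤ 1 / 16 := by
    rw [div_mul_eq_mul_div, div_le_iff₀ h2P]
    have : d * N ≤ d * (N₀ + N : ℕ) := mul_le_mul_of_nonneg_left (by exact_mod_cast Nat.le_add_left N N₀) hd0.le
    linarith
  -- `2/s ≤ 2 · 2^P / 2^e`
  have hinv : 2 / (d / 2 ^ P) ≤ 2 * 2 ^ P / 2 ^ e := by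
    rw [div_div_eq_mul_div, div_le_div_iff₀ hd0 (by positivity)]
    nlinarith
  unfold blockGamma
  have hI : (0 : ℝ) ≤ (Nat.log 2 M : ℝ) + 2 := by positivity
  calc ((Nat.log 2 M : ℝ) + 2) * ((d / 2 ^ P * N + 2) * (2 / (d / 2 ^ P))) + 2 * M * (d / 2 ^ P * N + 2)
      ≤ ((Nat.log 2 M : ℝ) + 2) * (2 * N + 2 * (2 * 2 ^ P / 2 ^ e)) + 2 * M * (1 / 16 + 2) := by
        gcongr ?_ * ?_ + ?_ * (?_ + 2)
        rw [show (d / 2 ^ P * N + 2) * (2 / (d / 2 ^ P)) = 2 * N + 2 * (2 / (d / 2 ^ P)) by field_simp]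
        gcongr
    _ = ((Nat.log 2 M : ℝ) + 2) * (2 * N + 4 * 2 ^ P / 2 ^ e) + 33 * M / 8 := by ring

/-- **The `e`-th short block (Bourgain 2013, (2.25)–(2.27)), structural form.** Let `a ≥ 0` and let
`J` be a function with `∑_{x ≤ k < x+Λ} a(k) ≤ J(Λ)` for all integers `x` and all `Λ ≥ 1`
(in the application, Lemma 6: `J(Λ) = 4Λ^κ`, or the trivial `J(Λ) = ‖a‖_∞ Λ`). Then the pair sum
over the block `2^e ≤ |k-k'| < 2^{e+1}` of short pairs is at most
`2 J(2^e) (2RL/2^{P₀} + 2) (Γ_e J(Λ(1/M + w_e)) + ∑_{i ≤ log₂ M} min(Γ_e, NM/2^{i+1}) J(Λ(2^{i+1}/M + w_e)))`,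
`Λ(η) = ⌊2η2^{P₀}⌋ + 1`: the partner `k'` of `k` lies in two windows of length `2^e` (factor
`2J(2^e)`); the `k` with `‖kℓ/2^{P₀}‖ < 1/M + w_e` may resonate (progression bound `Γ_e`), those
with `2^i/M + w_e ≤ ‖kℓ/2^{P₀}‖ < 2^{i+1}/M + w_e` keep all their phases at distance `≥ 2^i/M` from
`ℤ` (`n`-sum `≤ NM/2^{i+1}`), and each such set of `k` is confined to `2RL/2^{P₀} + 2` windows of
length `Λ(·)` (`sum_filter_distInt_mul_div_lt_le`). [cite: Bourgain2013MoebiusWalsh, (2.25)–(2.27)] -/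
theorem pairSum_block_le {a : ℤ → ℝ} (ha0 : ∀ k, 0 ≤ a k) {R M : ℕ} (hM : 0 < M) (K P₀ : ℕ)
    {ℓ : ℤ} (hℓ : ℓ ≠ 0) {L : ℕ} (hℓL : ℓ.natAbs ≤ L) (N₀ N e : ℕ) (J : ℕ → ℝ)
    (hJ : ∀ (x : ℤ) (Λ : ℕ), 1 ≤ Λ → ∑ k ∈ Ico x (x + Λ), a k ≤ J Λ) :
    ∑ n ∈ Ico N₀ (N₀ + N), ∑ k ∈ Ioo (-(R : ℤ)) R, ∑ k' ∈ Ioo (-(R : ℤ)) R,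
      (if InShortBlock K P₀ (N₀ + N) e k k' then a k * a k' * geomBound M (pairPhase K P₀ ℓ k k' n) else 0) ≤
      2 * J (2 ^ e) * ((2 * R * L / (2 : ℝ) ^ P₀ + 2) *
        (blockGamma M K P₀ N e * J (confLen P₀ (1 / M + blockW K P₀ (N₀ + N) e)) +
          ∑ i ∈ range (Nat.log 2 M + 1), min (blockGamma M K P₀ N e) ((N : ℝ) * M / 2 ^ (i + 1)) *
            J (confLen P₀ ((2 : ℝ) ^ (i + 1) / M + blockW K P₀ (N₀ + N) e)))) := by
  classical
  set I := Nat.log 2 M with hI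
  set Γ := blockGamma M K P₀ N e with hΓ
  set w := blockW K P₀ (N₀ + N) e with hw
  set Q : ℝ := (2 : ℝ) ^ P₀ with hQ
  set CR : ℝ := 2 * R * L / Q + 2 with hCR
  have hQ1 : 1 ≤ Q := by rw [hQ]; exact one_le_pow₀ (by norm_num)
  have hMr : (0 : ℝ) < M := by exact_mod_cast hM
  have hΓ0 : 0 ≤ Γ := blockGamma_nonneg _ _ _ _ _
  have hw0 : 0 ≤ w := blockW_nonneg _ _ _ _
  have h2I : (M : ℝ) < 2 ^ (I + 1) := by exact_mod_cast Nat.lt_pow_succ_log_self one_lt_two M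
  have hJ0 : ∀ Λ, 1 ≤ Λ → 0 ≤ J Λ := fun Λ hΛ =>
    le_trans (Finset.sum_nonneg fun k _ => ha0 k) (hJ 0 Λ hΛ)
  -- the distance of `kℓ/2^{P₀}` to `ℤ`
  set τ : ℤ → ℝ := fun k => distInt (((k * ℓ : ℤ) : ℝ) / Q) with hτ
  -- thresholds `η_{-1} = 1/M + w`, `η_i = 2^{i+1}/M + w`, and the majorant `Φ`
  set η : ℕ → ℝ := fun i => (2 : ℝ) ^ (i + 1) / M + w with hη
  set Φ : ℤ → ℝ := fun k => Γ * (if τ k < 1 / M + w then 1 else 0) +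
    ∑ i ∈ range (I + 1), min Γ ((N : ℝ) * M / 2 ^ (i + 1)) * (if τ k < η i then 1 else 0) with hΦ
  have hΦsummand_nonneg : ∀ k, ∀ i ∈ range (I + 1),
      0 ≤ min Γ ((N : ℝ) * M / 2 ^ (i + 1)) * (if τ k < η i then (1 : ℝ) else 0) := by
    intro k i _; split_ifs
    · rw [mul_one]; exact le_min hΓ0 (by positivity)
    · rw [mul_zero]
  -- Step 1: for a short pair, the `n`-sum is `≤ Φ(k)`
  have hstep1 : ∀ k k' : ℤ, InShortBlock K P₀ (N₀ + N) e k k' →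
      ∑ n ∈ Ico N₀ (N₀ + N), geomBound M (pairPhase K P₀ ℓ k k' n) ≤ Φ k := by
    intro k k' hb
    have hSΓ := sum_Ico_geomBound_pairPhase_le_blockGamma hM K P₀ ℓ hb
    rw [← hΓ] at hSΓ
    -- excursion bound
    have hexc : |((k - k' : ℤ) : ℝ)| * (N₀ + N : ℕ) / 2 ^ (K + P₀) ≤ w := by
      rw [hw, blockW, ← Int.cast_abs]
      refine div_le_div_of_nonneg_right ?_ (by positivity)
      refine mul_le_mul_of_nonneg_right ?_ (Nat.cast_nonneg _)
      exact_mod_cast hb.2.2.2.le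
    simp only [hΦ]
    by_cases h0 : τ k < 1 / M + w
    · rw [if_pos h0, mul_one]
      exact le_add_of_le_of_nonneg hSΓ (Finset.sum_nonneg (hΦsummand_nonneg k))
    · rw [if_neg h0, mul_zero, zero_add]
      have h0' := not_lt.mp h0
      have hex : ∃ i, τ k < η i := ⟨I, by
        simp only [hη]
        have h1 : τ k ≤ 1 / 2 := distInt_le_half _
        have h2 : (1 : ℝ) < 2 ^ (I + 1) / M := by rw [lt_div_iff₀ hMr]; linarith
        linarith⟩
      set i := Nat.find hex with hi
      have hi_spec : τ k < η i := Nat.find_spec hex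
      have hi_le : i ≤ I := Nat.find_min' hex (by
        simp only [hη]
        have h1 : τ k ≤ 1 / 2 := distInt_le_half _
        have h2 : (1 : ℝ) < 2 ^ (I + 1) / M := by rw [lt_div_iff₀ hMr]; linarith
        linarith)
      have hlow : (2 : ℝ) ^ i / M + w ≤ τ k := by
        rcases Nat.eq_zero_or_pos i with h | h
        · rw [h, pow_zero]; exact h0'
        · obtain ⟨j, hj⟩ : ∃ j, i = j + 1 := ⟨i - 1, by omega⟩
          have hmin := not_lt.mp (Nat.find_min hex (show j < Nat.find hex by rw [← hi]; omega))
          rw [hj]; exact hmin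
      -- far bound
      have hfar := sum_Ico_geomBound_pairPhase_le_of_far (M : ℝ) K P₀ ℓ k k' N₀ N
        (τ := (2 : ℝ) ^ i / M) (by positivity) hexc hlow
      have hmin : ∑ n ∈ Ico N₀ (N₀ + N), geomBound M (pairPhase K P₀ ℓ k k' n) ≤
          min Γ ((N : ℝ) * M / 2 ^ (i + 1)) := by
        refine le_min hSΓ (hfar.trans (le_of_eq ?_))
        rw [pow_succ]; field_simp
      calc ∑ n ∈ Ico N₀ (N₀ + N), geomBound M (pairPhase K P₀ ℓ k k' n)
          ≤ min Γ ((N : ℝ) * M / 2 ^ (i + 1)) * (if τ k < η i then 1 else 0) := by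
            rw [if_pos hi_spec, mul_one]; exact hmin
        _ ≤ ∑ i ∈ range (I + 1), min Γ ((N : ℝ) * M / 2 ^ (i + 1)) * (if τ k < η i then 1 else 0) :=
            Finset.single_le_sum (hΦsummand_nonneg k) (Finset.mem_range.2 (by omega))
  -- Step 2: the partners of `k` lie in two windows of length `2^e`
  have hstep2 : ∀ k : ℤ, ∑ k' ∈ Ioo (-(R : ℤ)) R,
      (if InShortBlock K P₀ (N₀ + N) e k k' then a k' else 0) ≤ 2 * J (2 ^ e) := by
    intro k
    have hsub : ∀ k' ∈ Ioo (-(R : ℤ)) R, InShortBlock K P₀ (N₀ + N) e k k' →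
        k' ∈ Ico (k - 2 ^ (e + 1) + 1) (k - 2 ^ (e + 1) + 1 + (2 ^ e : ℕ)) ∪
          Ico (k + 2 ^ e) (k + 2 ^ e + (2 ^ e : ℕ)) := by
      intro k' _ hb
      obtain ⟨_, _, hlo, hhi⟩ := hb
      rw [Finset.mem_union, Finset.mem_Ico, Finset.mem_Ico]
      push_cast
      have h2e : (2 : ℤ) ^ (e + 1) = 2 * 2 ^ e := by ring
      rw [h2e] at hhi
      rcases le_or_gt 0 (k - k') with h | h
      · rw [abs_of_nonneg h] at hlo hhi; left; constructor <;> linarith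
      · rw [abs_of_neg h] at hlo hhi; right; constructor <;> linarith
    calc ∑ k' ∈ Ioo (-(R : ℤ)) R, (if InShortBlock K P₀ (N₀ + N) e k k' then a k' else 0)
        ≤ ∑ k' ∈ Ico (k - 2 ^ (e + 1) + 1) (k - 2 ^ (e + 1) + 1 + (2 ^ e : ℕ)) ∪
            Ico (k + 2 ^ e) (k + 2 ^ e + (2 ^ e : ℕ)), a k' := by
          rw [← Finset.sum_filter]
          refine Finset.sum_le_sum_of_subset_of_nonneg ?_ fun k' _ _ => ha0 k'
          intro k' hk'
          rw [Finset.mem_filter] at hk'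
          exact hsub k' hk'.1 hk'.2
      _ ≤ ∑ k' ∈ Ico (k - 2 ^ (e + 1) + 1) (k - 2 ^ (e + 1) + 1 + (2 ^ e : ℕ)), a k' +
            ∑ k' ∈ Ico (k + 2 ^ e) (k + 2 ^ e + (2 ^ e : ℕ)), a k' := by
          rw [← Finset.sum_union_inter]
          exact le_add_of_nonneg_right (Finset.sum_nonneg fun k' _ => ha0 k')
      _ ≤ J (2 ^ e) + J (2 ^ e) := add_le_add (hJ _ _ (Nat.one_le_two_pow)) (hJ _ _ (Nat.one_le_two_pow))
      _ = 2 * J (2 ^ e) := by ring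
  have hJe0 : 0 ≤ 2 * J (2 ^ e) := mul_nonneg zero_le_two (hJ0 _ Nat.one_le_two_pow)
  -- Step 3: confinement of the `k` with `τ k < η'`
  have hstep3 : ∀ η' : ℝ, 0 < η' →
      ∑ k ∈ Ioo (-(R : ℤ)) R, a k * (if τ k < η' then 1 else 0) ≤ CR * J (confLen P₀ η') := by
    intro η' hη'
    have h := sum_filter_distInt_mul_div_lt_le ha0 hQ1 hℓ hℓL R hη' (B := J (confLen P₀ η'))
      (fun x => hJ x _ (one_le_confLen P₀ η'))
    rw [Finset.sum_filter] at h
    refine le_trans (le_of_eq (Finset.sum_congr rfl fun k _ => ?_)) h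
    split_ifs <;> simp
  -- Step 4: assemble
  have hΦ0 : ∀ k, 0 ≤ Φ k := fun k => by
    simp only [hΦ]
    refine add_nonneg ?_ (Finset.sum_nonneg (hΦsummand_nonneg k))
    split_ifs
    · rw [mul_one]; exact hΓ0
    · rw [mul_zero]
  calc ∑ n ∈ Ico N₀ (N₀ + N), ∑ k ∈ Ioo (-(R : ℤ)) R, ∑ k' ∈ Ioo (-(R : ℤ)) R,
        (if InShortBlock K P₀ (N₀ + N) e k k' then a k * a k' * geomBound M (pairPhase K P₀ ℓ k k' n) else 0)
      = ∑ k ∈ Ioo (-(R : ℤ)) R, ∑ k' ∈ Ioo (-(R : ℤ)) R,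
          (if InShortBlock K P₀ (N₀ + N) e k k' then
            a k * a k' * ∑ n ∈ Ico N₀ (N₀ + N), geomBound M (pairPhase K P₀ ℓ k k' n) else 0) := by
        rw [Finset.sum_comm]
        refine Finset.sum_congr rfl fun k _ => ?_
        rw [Finset.sum_comm]
        refine Finset.sum_congr rfl fun k' _ => ?_
        split_ifs
        · rw [Finset.mul_sum]
        · simp
    _ ≤ ∑ k ∈ Ioo (-(R : ℤ)) R, ∑ k' ∈ Ioo (-(R : ℤ)) R,
          a k * Φ k * (if InShortBlock K P₀ (N₀ + N) e k k' then a k' else 0) := by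
        refine Finset.sum_le_sum fun k _ => Finset.sum_le_sum fun k' _ => ?_
        split_ifs with hb
        · calc a k * a k' * ∑ n ∈ Ico N₀ (N₀ + N), geomBound M (pairPhase K P₀ ℓ k k' n)
              ≤ a k * a k' * Φ k := mul_le_mul_of_nonneg_left (hstep1 k k' hb) (mul_nonneg (ha0 k) (ha0 k'))
            _ = a k * Φ k * a k' := by ring
        · rw [mul_zero]
    _ = ∑ k ∈ Ioo (-(R : ℤ)) R, a k * Φ k *
          ∑ k' ∈ Ioo (-(R : ℤ)) R, (if InShortBlock K P₀ (N₀ + N) e k k' then a k' else 0) := by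
        refine Finset.sum_congr rfl fun k _ => ?_; rw [Finset.mul_sum]
    _ ≤ ∑ k ∈ Ioo (-(R : ℤ)) R, a k * Φ k * (2 * J (2 ^ e)) := by
        refine Finset.sum_le_sum fun k _ => ?_
        exact mul_le_mul_of_nonneg_left (hstep2 k) (mul_nonneg (ha0 k) (hΦ0 k))
    _ = 2 * J (2 ^ e) * (Γ * ∑ k ∈ Ioo (-(R : ℤ)) R, a k * (if τ k < 1 / M + w then 1 else 0) +
          ∑ i ∈ range (I + 1), min Γ ((N : ℝ) * M / 2 ^ (i + 1)) *
            ∑ k ∈ Ioo (-(R : ℤ)) R, a k * (if τ k < η i then 1 else 0)) := by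
        rw [← Finset.sum_mul, mul_comm]
        congr 1
        simp only [hΦ, mul_add, Finset.sum_add_distrib, Finset.mul_sum]
        congr 1
        · refine Finset.sum_congr rfl fun k _ => ?_; ring
        · rw [Finset.sum_comm]
          refine Finset.sum_congr rfl fun i _ => Finset.sum_congr rfl fun k _ => ?_; ring
    _ ≤ 2 * J (2 ^ e) * (Γ * (CR * J (confLen P₀ (1 / M + w))) +
          ∑ i ∈ range (I + 1), min Γ ((N : ℝ) * M / 2 ^ (i + 1)) * (CR * J (confLen P₀ (η i)))) := by
        refine mul_le_mul_of_nonneg_left ?_ hJe0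
        refine add_le_add (mul_le_mul_of_nonneg_left (hstep3 _ (by positivity)) hΓ0)
          (Finset.sum_le_sum fun i _ => ?_)
        refine mul_le_mul_of_nonneg_left (hstep3 _ ?_) (le_min hΓ0 (by positivity))
        simp only [hη]; positivity
    _ = _ := by
        simp only [hη]
        congr 1
        rw [mul_add, Finset.mul_sum]
        congr 1
        · ring
        · refine Finset.sum_congr rfl fun i _ => ?_; ring


/-! ### Decomposition of the pair sum: diagonal + long arcs + short blocks -/

/-- Every term of the pair sum is on the diagonal, a long arc, or in one of the short blocks
`e < E` (`2R ≤ 2^E`). [cite: Bourgain2013MoebiusWalsh, §2, (2.13), (2.24), (2.25)] -/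
theorem pairSum_le_parts {a : ℤ → ℝ} (ha0 : ∀ k, 0 ≤ a k) {R : ℕ} (M K P₀ : ℕ) (ℓ : ℤ) (N₀ N : ℕ)
    {E : ℕ} (hE : 2 * R ≤ 2 ^ E) :
    pairSum a R M K P₀ ℓ N₀ N ≤
      (∑ n ∈ Ico N₀ (N₀ + N), ∑ k ∈ Ioo (-(R : ℤ)) R, a k * a k * geomBound M (pairPhase K P₀ ℓ k k n)) +
      (∑ n ∈ Ico N₀ (N₀ + N), ∑ k ∈ Ioo (-(R : ℤ)) R, ∑ k' ∈ Ioo (-(R : ℤ)) R,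
        (if (2 : ℤ) ^ (K + P₀) < 16 * ((N₀ + N : ℕ) : ℤ) * |k - k'| then
          a k * a k' * geomBound M (pairPhase K P₀ ℓ k k' n) else 0)) +
      ∑ e ∈ range E, ∑ n ∈ Ico N₀ (N₀ + N), ∑ k ∈ Ioo (-(R : ℤ)) R, ∑ k' ∈ Ioo (-(R : ℤ)) R,
        (if InShortBlock K P₀ (N₀ + N) e k k' then a k * a k' * geomBound M (pairPhase K P₀ ℓ k k' n) else 0) := by
  classical
  set f : ℕ → ℤ → ℤ → ℝ := fun n k k' => a k * a k' * geomBound M (pairPhase K P₀ ℓ k k' n) with hf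
  have hf0 : ∀ n k k', 0 ≤ f n k k' := fun n k k' =>
    mul_nonneg (mul_nonneg (ha0 k) (ha0 k')) (geomBound_nonneg (Nat.cast_nonneg M) _)
  -- pointwise trichotomy
  have hpt : ∀ n, ∀ k ∈ Ioo (-(R : ℤ)) R, ∀ k' ∈ Ioo (-(R : ℤ)) R, f n k k' ≤
      (if k = k' then f n k k' else 0) +
      (if (2 : ℤ) ^ (K + P₀) < 16 * ((N₀ + N : ℕ) : ℤ) * |k - k'| then f n k k' else 0) +
      ∑ e ∈ range E, (if InShortBlock K P₀ (N₀ + N) e k k' then f n k k' else 0) := by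
    intro n k hk k' hk'
    rw [Finset.mem_Ioo] at hk hk'
    have hsum0 : 0 ≤ ∑ e ∈ range E, (if InShortBlock K P₀ (N₀ + N) e k k' then f n k k' else 0) :=
      Finset.sum_nonneg fun e _ => by split_ifs <;> [exact hf0 n k k'; exact le_rfl]
    by_cases hkk : k = k'
    · rw [if_pos hkk]
      refine le_add_of_le_of_nonneg (le_add_of_le_of_nonneg le_rfl ?_) hsum0
      split_ifs <;> [exact hf0 n k k'; exact le_rfl]
    rw [if_neg hkk, zero_add]
    by_cases hlong : (2 : ℤ) ^ (K + P₀) < 16 * ((N₀ + N : ℕ) : ℤ) * |k - k'|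
    · rw [if_pos hlong]; exact le_add_of_nonneg_right hsum0
    rw [if_neg hlong, zero_add]
    -- the block of `|k - k'|`
    set e := Nat.log 2 (k - k').natAbs with he
    have hd1 : 1 ≤ (k - k').natAbs := Int.one_le_abs (sub_ne_zero.2 hkk) |> fun h => by
      have := Int.natAbs_pos.2 (sub_ne_zero.2 hkk); omega
    have habs : |k - k'| = ((k - k').natAbs : ℤ) := (Int.natCast_natAbs _).symm
    have hlo : (2 : ℤ) ^ e ≤ |k - k'| := by
      rw [habs]; exact_mod_cast Nat.pow_log_le_self 2 (by omega)
    have hhi : |k - k'| < (2 : ℤ) ^ (e + 1) := by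
      rw [habs]; exact_mod_cast Nat.lt_pow_succ_log_self one_lt_two _
    have heE : e < E := by
      have h2R : (k - k').natAbs < 2 ^ E := by
        have : |k - k'| < 2 * R := by rw [abs_lt]; constructor <;> omega
        rw [habs] at this
        have h3 : (k - k').natAbs < 2 * R := by exact_mod_cast this
        exact lt_of_lt_of_le h3 hE
      rw [he]
      exact Nat.log_lt_of_lt_pow (by omega) h2R
    have hblock : InShortBlock K P₀ (N₀ + N) e k k' := ⟨hkk, not_lt.mp hlong, hlo, hhi⟩
    calc f n k k' = (if InShortBlock K P₀ (N₀ + N) e k k' then f n k k' else 0) := by rw [if_pos hblock]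
      _ ≤ ∑ e ∈ range E, (if InShortBlock K P₀ (N₀ + N) e k k' then f n k k' else 0) :=
          Finset.single_le_sum (f := fun e' => if InShortBlock K P₀ (N₀ + N) e' k k' then f n k k' else 0)
            (fun e' _ => by
              show 0 ≤ (if InShortBlock K P₀ (N₀ + N) e' k k' then f n k k' else 0)
              split_ifs <;> [exact hf0 n k k'; exact le_rfl])
            (Finset.mem_range.2 heE)
  -- sum it
  calc pairSum a R M K P₀ ℓ N₀ N = ∑ n ∈ Ico N₀ (N₀ + N), ∑ k ∈ Ioo (-(R : ℤ)) R,
        ∑ k' ∈ Ioo (-(R : ℤ)) R, f n k k' := rfl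
    _ ≤ ∑ n ∈ Ico N₀ (N₀ + N), ∑ k ∈ Ioo (-(R : ℤ)) R, ∑ k' ∈ Ioo (-(R : ℤ)) R,
        ((if k = k' then f n k k' else 0) +
          (if (2 : ℤ) ^ (K + P₀) < 16 * ((N₀ + N : ℕ) : ℤ) * |k - k'| then f n k k' else 0) +
          ∑ e ∈ range E, (if InShortBlock K P₀ (N₀ + N) e k k' then f n k k' else 0)) :=
        Finset.sum_le_sum fun n _ => Finset.sum_le_sum fun k hk => Finset.sum_le_sum fun k' hk' =>
          hpt n k hk k' hk'
    _ = _ := by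
        simp only [Finset.sum_add_distrib]
        congr 1
        · congr 1
          refine Finset.sum_congr rfl fun n _ => Finset.sum_congr rfl fun k hk => ?_
          rw [Finset.sum_ite_eq]
          rw [if_pos hk]
        · symm
          rw [Finset.sum_comm]
          refine Finset.sum_congr rfl fun n _ => ?_
          rw [Finset.sum_comm]
          refine Finset.sum_congr rfl fun k _ => ?_
          rw [Finset.sum_comm]


/-! ### The Fourier expansion step for the localised factor `W` (Bourgain 2013, (2.8), (2.11)) -/

section Walsh

open Literature.NumberTheory.LFunctions.MoebiusWalsh

/-- **(2.11) for the shifted window.** For the localised substitute `W = W_A` of Lemma 5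
(`localisedWalshRe q σ K₁ A`, frequencies `|k| < R = 2K₁2^σ`, coefficients `c = localisedCoeff`),
every `n`, lag `h·2^q` and window `[M₀, M₀+M)` of the smooth variable:
`|∑_{M₀ ≤ m < M₀+M} W(m(n + h2^q)) W(mn)| ≤ ∑_{|k|,|k'|<R} |c(k)| |c(k')| min(M, 1/(2‖θ_{k,k'}(n)‖))`,
`θ_{k,k'}(n) = (k-k')n/2^{q+σ} + kh/2^σ` (expand both factors, `W` being real the second one
through `conj`, and sum the geometric series in `m`). [cite: Bourgain2013MoebiusWalsh, (2.8), (2.11)] -/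
theorem abs_sum_Ico_localisedWalshRe_mul_le (q σ K₁ : ℕ) (A : Finset (Fin (q + σ)))
    (n h M₀ M : ℕ) :
    |∑ m ∈ Ico M₀ (M₀ + M), localisedWalshRe q σ K₁ A (m * (n + h * 2 ^ q)) *
        localisedWalshRe q σ K₁ A (m * n)| ≤
      ∑ k ∈ Ioo (-((2 * (K₁ * 2 ^ σ) : ℕ) : ℤ)) ((2 * (K₁ * 2 ^ σ) : ℕ) : ℤ),
        ∑ k' ∈ Ioo (-((2 * (K₁ * 2 ^ σ) : ℕ) : ℤ)) ((2 * (K₁ * 2 ^ σ) : ℕ) : ℤ),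
          ‖localisedCoeff q σ K₁ A k‖ * ‖localisedCoeff q σ K₁ A k'‖ *
            geomBound M (pairPhase q σ h k k' n) := by
  set Rz : ℤ := ((2 * (K₁ * 2 ^ σ) : ℕ) : ℤ) with hRz
  set c := localisedCoeff q σ K₁ A with hc
  set W := localisedWalshRe q σ K₁ A with hW
  set n' := n + h * 2 ^ q with hn'
  set S := ∑ m ∈ Ico M₀ (M₀ + M), W (m * n') * W (m * n) with hS
  -- the product of the two expansions
  have hprod : ∀ m : ℕ, ((W (m * n') * W (m * n) : ℝ) : ℂ) =
      ∑ k ∈ Ioo (-Rz) Rz, ∑ k' ∈ Ioo (-Rz) Rz,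
        c k * starRingEnd ℂ (c k') * eChar (-(pairPhase q σ h k k' n) * m) := by
    intro m
    have h1 : ((W (m * n') : ℝ) : ℂ) = localisedWalsh q σ K₁ A (m * n') := coe_localisedWalshRe _ _ _ _ _
    have h2 : ((W (m * n) : ℝ) : ℂ) = starRingEnd ℂ (localisedWalsh q σ K₁ A (m * n)) := by
      rw [conj_localisedWalsh]; exact coe_localisedWalshRe _ _ _ _ _
    rw [Complex.ofReal_mul, h1, h2]
    unfold localisedWalsh
    rw [map_sum, Finset.sum_mul]
    refine Finset.sum_congr rfl fun k _ => ?_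
    rw [Finset.mul_sum]
    refine Finset.sum_congr rfl fun k' _ => ?_
    rw [map_mul, conj_eChar, mul_mul_mul_comm, ← eChar_add]
    congr 1
    congr 1
    rw [pairPhase, hn']
    push_cast
    field_simp
    ring
  have hSC : (S : ℂ) = ∑ k ∈ Ioo (-Rz) Rz, ∑ k' ∈ Ioo (-Rz) Rz,
      c k * starRingEnd ℂ (c k') * ∑ m ∈ Ico M₀ (M₀ + M), eChar (-(pairPhase q σ h k k' n) * m) := by
    rw [hS, Complex.ofReal_sum]
    simp_rw [hprod]
    rw [Finset.sum_comm]
    refine Finset.sum_congr rfl fun k _ => ?_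
    rw [Finset.sum_comm]
    refine Finset.sum_congr rfl fun k' _ => ?_
    rw [Finset.mul_sum]
  have hnormS : |S| = ‖(S : ℂ)‖ := by rw [Complex.norm_real, Real.norm_eq_abs]
  rw [hnormS, hSC]
  refine (norm_sum_le _ _).trans (Finset.sum_le_sum fun k _ => ?_)
  refine (norm_sum_le _ _).trans (Finset.sum_le_sum fun k' _ => ?_)
  rw [norm_mul, norm_mul, Complex.norm_conj]
  refine mul_le_mul_of_nonneg_left ?_ (mul_nonneg (norm_nonneg _) (norm_nonneg _))
  rw [← geomBound_neg]
  exact norm_sum_Ico_eChar_le_geomBound _ _ _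

/-- Summing (2.11) over the long variable gives the pair sum. [cite: Bourgain2013MoebiusWalsh, (2.11)] -/
theorem sum_abs_sum_localisedWalshRe_mul_le_pairSum (q σ K₁ : ℕ) (A : Finset (Fin (q + σ)))
    (h M₀ M N₀ N : ℕ) :
    ∑ n ∈ Ico N₀ (N₀ + N), |∑ m ∈ Ico M₀ (M₀ + M), localisedWalshRe q σ K₁ A (m * (n + h * 2 ^ q)) *
        localisedWalshRe q σ K₁ A (m * n)| ≤
      pairSum (fun k => ‖localisedCoeff q σ K₁ A k‖) (2 * (K₁ * 2 ^ σ)) M q σ h N₀ N := by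
  unfold pairSum
  exact Finset.sum_le_sum fun n _ => abs_sum_Ico_localisedWalshRe_mul_le q σ K₁ A n h M₀ M

/-! ### The Fourier data of `W`: sup, windows (Lemma 6), `ℓ¹` ((1.11)) -/

/-- **Sup bound** (Lemma 2 through (1.13)): `|c(k)| ≤ 2·2^{-c₂|A|}`, `c₂ = walshSupExponent`.
[cite: Bourgain2013MoebiusWalsh, (2.9)] -/
theorem norm_localisedCoeff_le_sup (q σ K₁ : ℕ) (A : Finset (Fin (q + σ))) (k : ℤ) :
    ‖localisedCoeff q σ K₁ A k‖ ≤ 2 * (2 : ℝ) ^ (-(walshSupExponent * A.card)) :=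
  (norm_localisedCoeff_le q σ K₁ A k).trans (norm_walshCoeff_le_two_mul_rpow A _)

/-- **Window bound** (Lemma 6 through (1.13)): for every integer `x` and `1 ≤ Λ ≤ 2^{q+σ}`,
`∑_{x ≤ k < x+Λ} |c(k)| ≤ 4 Λ^κ`, `κ = walshL1Exponent` (shift the window by a multiple of the
period `2^{q+σ}` into `ℕ` and apply the tree's Lemma 6). [cite: Bourgain2013MoebiusWalsh, Lemma 6 (1.24)] -/
theorem sum_Ico_norm_localisedCoeff_le (q σ K₁ : ℕ) (A : Finset (Fin (q + σ))) (x : ℤ) {Λ : ℕ}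
    (hΛ1 : 1 ≤ Λ) (hΛ : Λ ≤ 2 ^ (q + σ)) :
    ∑ k ∈ Ico x (x + Λ), ‖localisedCoeff q σ K₁ A k‖ ≤ 4 * (Λ : ℝ) ^ walshL1Exponent := by
  set t : ℕ := x.natAbs with ht
  -- `x + t 2^{q+σ} ≥ 0`
  have hx0 : 0 ≤ x + t * 2 ^ (q + σ) := by
    have h1 : -(t : ℤ) ≤ x := by
      rw [ht, Int.natCast_natAbs]; exact neg_abs_le x
    have h2 : (t : ℤ) ≤ t * 2 ^ (q + σ) :=
      le_mul_of_one_le_right (by positivity) (by exact_mod_cast Nat.one_le_two_pow)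
    omega
  set a₀ : ℕ := (x + t * 2 ^ (q + σ)).toNat with ha₀
  have ha₀x : (a₀ : ℤ) = x + t * 2 ^ (q + σ) := Int.toNat_of_nonneg hx0
  calc ∑ k ∈ Ico x (x + Λ), ‖localisedCoeff q σ K₁ A k‖
      ≤ ∑ k ∈ Ico x (x + Λ), ‖walshCoeff A ((k : ℝ) / 2 ^ (q + σ))‖ :=
        Finset.sum_le_sum fun k _ => norm_localisedCoeff_le q σ K₁ A k
    _ = ∑ j ∈ range Λ, ‖walshCoeff A (((x + j : ℤ) : ℝ) / 2 ^ (q + σ))‖ := sum_Ico_int_eq_sum_range _ x Λ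
    _ = ∑ j ∈ range Λ, ‖walshCoeff A ((((a₀ + j : ℕ)) : ℝ) / 2 ^ (q + σ))‖ := by
        refine Finset.sum_congr rfl fun j _ => ?_
        rw [← walshCoeff_add_int A (((x + j : ℤ) : ℝ) / 2 ^ (q + σ)) t]
        congr 2
        have : ((a₀ + j : ℕ) : ℝ) = ((x + t * 2 ^ (q + σ) + j : ℤ) : ℝ) := by
          rw [← ha₀x]; push_cast; ring
        rw [this]; push_cast; field_simp; ring
    _ = ∑ k ∈ Ico a₀ (a₀ + Λ), ‖walshCoeff A ((k : ℝ) / 2 ^ (q + σ))‖ := by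
        rw [Finset.sum_Ico_eq_sum_range, show a₀ + Λ - a₀ = Λ by omega]
    _ ≤ 4 * (Λ : ℝ) ^ walshL1Exponent := sum_Ico_norm_walshCoeff_le_rpow A a₀ Λ hΛ1 hΛ

/-- **`ℓ¹` bound** ((1.11) through (1.13)): if the digits of `A` are all `≥ q` (the window sits on
top of `K = q` untouched digits) and `4K₁ ≤ 2^q`, then
`∑_{|k| < 2K₁2^σ} |c(k)| ≤ 4(q+2) 2^{κσ}` (two periods of `|ŵ_A|`, each bounded by the tree's
form of (1.11)). [cite: Bourgain2013MoebiusWalsh, (1.11), (2.10)] -/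
theorem sum_Ioo_norm_localisedCoeff_le {q σ K₁ : ℕ} (A : Finset (Fin (q + σ)))
    (hA : ∀ j ∈ A, q ≤ (j : ℕ)) (hKq : 4 * K₁ ≤ 2 ^ q) :
    ∑ k ∈ Ioo (-((2 * (K₁ * 2 ^ σ) : ℕ) : ℤ)) ((2 * (K₁ * 2 ^ σ) : ℕ) : ℤ), ‖localisedCoeff q σ K₁ A k‖ ≤
      4 * ((q : ℝ) + 2) * (2 : ℝ) ^ (walshL1Exponent * σ) := by
  set R : ℕ := 2 * (K₁ * 2 ^ σ) with hR
  have hRP : R ≤ 2 ^ (q + σ) := by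
    rw [hR, pow_add]
    calc 2 * (K₁ * 2 ^ σ) = (2 * K₁) * 2 ^ σ := by ring
      _ ≤ 2 ^ q * 2 ^ σ := Nat.mul_le_mul_right _ (by omega)
  have hper : ∀ k : ℤ, ‖walshCoeff A (((k + (2 ^ (q + σ) : ℕ) : ℤ) : ℝ) / 2 ^ (q + σ))‖ =
      ‖walshCoeff A ((k : ℝ) / 2 ^ (q + σ))‖ := by
    intro k
    rw [← walshCoeff_add_int A ((k : ℝ) / 2 ^ (q + σ)) 1]
    congr 2; push_cast; field_simp
  have hperiod : ∑ k ∈ range (2 ^ (q + σ)), ‖walshCoeff A ((k : ℝ) / 2 ^ (q + σ))‖ ≤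
      2 * ((q : ℝ) + 2) * (2 : ℝ) ^ (walshL1Exponent * σ) := by
    have h := sum_norm_walshCoeff_le_of_forall_le A (Nat.le_add_right q σ) hA
    rwa [show q + σ - q = σ by omega] at h
  -- `(-R, R) ⊆ [-2^P, 0) ∪ [0, 2^P)`: two periods
  have hsub : Ioo (-(R : ℤ)) R ⊆ Ico (-((2 ^ (q + σ) : ℕ) : ℤ)) (-((2 ^ (q + σ) : ℕ) : ℤ) + (2 ^ (q + σ) : ℕ)) ∪
      Ico (0 : ℤ) ((0 : ℤ) + (2 ^ (q + σ) : ℕ)) := by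
    intro k hk
    rw [Finset.mem_Ioo] at hk
    rw [Finset.mem_union, Finset.mem_Ico, Finset.mem_Ico]
    have : (R : ℤ) ≤ ((2 ^ (q + σ) : ℕ) : ℤ) := by exact_mod_cast hRP
    omega
  have hwin : ∀ b : ℤ, ∑ k ∈ Ico b (b + (2 ^ (q + σ) : ℕ)), ‖walshCoeff A ((k : ℝ) / 2 ^ (q + σ))‖ =
      ∑ k ∈ range (2 ^ (q + σ)), ‖walshCoeff A ((k : ℝ) / 2 ^ (q + σ))‖ := by
    intro b
    rw [sum_Ico_int_window_eq_of_periodic (f := fun k : ℤ => ‖walshCoeff A ((k : ℝ) / 2 ^ (q + σ))‖)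
      (P := 2 ^ (q + σ)) (fun k => hper k) b 0, sum_Ico_int_eq_sum_range]
    refine Finset.sum_congr rfl fun j _ => ?_
    push_cast; ring_nf
  calc ∑ k ∈ Ioo (-(R : ℤ)) R, ‖localisedCoeff q σ K₁ A k‖
      ≤ ∑ k ∈ Ioo (-(R : ℤ)) R, ‖walshCoeff A ((k : ℝ) / 2 ^ (q + σ))‖ :=
        Finset.sum_le_sum fun k _ => norm_localisedCoeff_le q σ K₁ A k
    _ ≤ ∑ k ∈ Ico (-((2 ^ (q + σ) : ℕ) : ℤ)) (-((2 ^ (q + σ) : ℕ) : ℤ) + (2 ^ (q + σ) : ℕ)) ∪ Ico (0 : ℤ) ((0 : ℤ) + (2 ^ (q + σ) : ℕ)),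
          ‖walshCoeff A ((k : ℝ) / 2 ^ (q + σ))‖ :=
        Finset.sum_le_sum_of_subset_of_nonneg hsub fun k _ _ => norm_nonneg _
    _ ≤ ∑ k ∈ Ico (-((2 ^ (q + σ) : ℕ) : ℤ)) (-((2 ^ (q + σ) : ℕ) : ℤ) + (2 ^ (q + σ) : ℕ)), ‖walshCoeff A ((k : ℝ) / 2 ^ (q + σ))‖ +
          ∑ k ∈ Ico (0 : ℤ) ((0 : ℤ) + (2 ^ (q + σ) : ℕ)), ‖walshCoeff A ((k : ℝ) / 2 ^ (q + σ))‖ := by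
        rw [← Finset.sum_union_inter]
        exact le_add_of_nonneg_right (Finset.sum_nonneg fun k _ => norm_nonneg _)
    _ = 2 * ∑ k ∈ range (2 ^ (q + σ)), ‖walshCoeff A ((k : ℝ) / 2 ^ (q + σ))‖ := by rw [hwin, hwin]; ring
    _ ≤ 2 * (2 * ((q : ℝ) + 2) * (2 : ℝ) ^ (walshL1Exponent * σ)) :=
        mul_le_mul_of_nonneg_left hperiod zero_le_two
    _ = 4 * ((q : ℝ) + 2) * (2 : ℝ) ^ (walshL1Exponent * σ) := by ring

end Walsh


end Literature.NumberTheory.LFunctions.MoebiusWalsh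

end
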